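import Literature.Barriers.PneNP.TSPExtensionComplexityRothvossCore
import Literature.Barriers.PneNP.TSPExtensionComplexityEntropy
import HarnessLib
import Mathlib.Data.Fintype.BigOperators
import Literature.Barriers.PneNP.TSPExtensionComplexityRothvossTransport
import Literature.Barriers.PneNP.TSPExtensionComplexityPMtoTSP
import Mathlib.Analysis.SpecialFunctions.Pow.Real
import Mathlib.Analysis.SpecialFunctions.Log.Basic
import Mathlib.Analysis.Complex.ExponentialBounds
import Mathlib.Data.Sym.Card
import Mathlib.Tactic.IrreducibleDef

/-!
# Rothvoß 2017 for TSP — Lemmas 14, 15, 7, 6 and the discharge `Rothvoss2017_tsp_holds`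

This module concatenates, in dependency order, the support files listed below (each keeps its own
module docstring); see those docstrings for the mathematical content and the sources.

Parts: TSPExtensionComplexityRothvossUBad, TSPExtensionComplexityRothvossMsupH, TSPExtensionComplexityRothvossMBad, TSPExtensionComplexityRothvossLemma7, TSPExtensionComplexityRothvossFinal.
-/


/-! ## Part: `TSPExtensionComplexityRothvossUBad` -/

/-!
# Rothvoß's Lemma 14: few compatible partitions are `U`-bad

Support file for the discharge of `Literature.Barriers.PneNP.Rothvoss2017_tsp` (Rothvoß 2017,
Lemma 14, PDF pp. 11–12). Fix a rectangle `ℛ = 𝒰 × ℳ`, a pair `(U*, M*)` and the threshold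
`θ = 2^{-δm}`. Among the partitions `π` compatible with `(U*, M*)` (i.e. `U* ∈ 𝒰ex(π)`,
`M* ∈ ℳex(π)`), at most a quarter are "`U`-bad" (neither small nor `U`-good), provided `m` is
large (hypothesis `hβ`). Proof as printed, with the re-randomisation realised by the slot
permutations `aSwap i` of `…RothvossTheta.lean` and the generic `card_filter_and_le_of_fibres`:
POINTWISE in `π`, the indices `i` with `aSwap i · π` compatible are those outside the index set
`I*` of `U* = U_{I*}` (`(m+1)/2` of them), and an index that is compatible and `U`-bad is an
`ε/4`-biased coordinate of the family `Y = {𝟙_I : |I| = μ+1, U_I ∈ 𝒰} ⊆ {0,1}^{m+1}`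
(`biased_of_ubad`), whose number the entropy lemma (`card_biased_mul_le_log`, Rothvoß's
Lemma 10) bounds by `(Real.log 2 + Real.log(m+1) - Real.log θ)/c` once one index is not small (then
`|Y| > θ · C(m, μ+1) ≥ θ 2^m/(m+1)`).

Sources: [Rothvoss2017] Lemma 14 and its proof (PDF pp. 11–12), Cor. 12 (PDF p. 11).
-/

noncomputable section

open scoped Classical

namespace Literature.Barriers.PneNP

open Finset Slot

variable {m q : ℕ}

section

variable (μ : ℕ) (ε θ : ℝ) (𝒰 : Finset (Finset (Slot m q))) (ℳ : Finset (Finset (Sym2 (Slot m q))))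
  (Ustar : Finset (Slot m q)) (Mstar : Finset (Sym2 (Slot m q)))

/-- `π` is compatible with `(U*, M*)`: `U* ∈ 𝒰ex(π)` and `M* ∈ ℳex(π)` ("`T ∈ 𝒫(U,M)`").
[cite: Rothvoss2017, §3.6 (PDF p. 11)] -/
def Compat (π : Equiv.Perm (Slot m q)) : Prop := Ustar ∈ Uex3 μ π ∧ Mstar ∈ Mex3 π

/-- `U`-bad: neither small nor `U`-good. [cite: Rothvoss2017, §3.6 (PDF p. 11)] -/
def UBad (π : Equiv.Perm (Slot m q)) : Prop := ¬Small μ θ 𝒰 ℳ π ∧ ¬UGood μ ε 𝒰 π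

/-- The constant of the entropy lemma for `ε/4`-bias on binary coordinates. [folklore] -/
def cU (ε : ℝ) : ℝ := (ε / 4 / ((1 + ε / 4) * (2 : ℕ))) ^ 2 / 2

end

/-! ### The family `Y` of index vectors of cuts in `𝒰` -/

section family

variable (μ : ℕ) (𝒰 : Finset (Finset (Slot m q))) (π : Equiv.Perm (Slot m q))

/-- The `(μ+1)`-subsets `I` with `U_I ∈ 𝒰`. [folklore] -/
def goodIdx : Finset (Finset (Fin (m + 1))) :=
  ((univ : Finset (Fin (m + 1))).powersetCard (μ + 1)).filter fun I => cutOf π I ∈ 𝒰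

/-- Their indicator vectors `Y ⊆ {0,1}^{m+1}`. [cite: Rothvoss2017, proof of Lemma 14 (PDF p. 12)] -/
def Yfam : Finset (Fin (m + 1) → Bool) := (goodIdx μ 𝒰 π).image fun I j => decide (j ∈ I)

/-- Auxiliary (`ind_injective`). [folklore] -/
theorem ind_injective : Function.Injective fun (I : Finset (Fin (m + 1))) (j : Fin (m + 1)) => decide (j ∈ I) := by
  intro I I' h
  ext j
  have := congrFun h j
  simpa using this

/-- Auxiliary (`card_Yfam_filter`). [folklore] -/
theorem card_Yfam_filter (i : Fin (m + 1)) (bb : Bool) :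
    ((Yfam μ 𝒰 π).filter fun y => y i = bb).card = ((goodIdx μ 𝒰 π).filter fun I => decide (i ∈ I) = bb).card := by
  rw [Yfam, filter_image, card_image_of_injective _ ind_injective]

/-- `|𝒰ex(aSwap i · π) ∩ 𝒰|` counts the `I ∈ goodIdx` avoiding `i`. [folklore] -/
theorem card_Uex3_aSwap_inter (hq : 0 < q) (i : Fin (m + 1)) :
    ((Uex3 μ (aSwap i * π) ∩ 𝒰).card) = ((Yfam μ 𝒰 π).filter fun y => y i = false).card := by
  rw [card_Yfam_filter]
  have : Uex3 μ (aSwap i * π) ∩ 𝒰 = ((goodIdx μ 𝒰 π).filter fun I => decide (i ∈ I) = false).image (cutOf π) := by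
    ext U
    simp only [mem_inter, mem_Uex3_aSwap_mul_iff i π hq, mem_image, mem_filter, goodIdx, mem_powersetCard,
      decide_eq_false_iff_not, subset_univ, true_and]
    constructor
    · rintro ⟨⟨I, hI, hiI, rfl⟩, hU⟩; exact ⟨I, ⟨⟨hI, hU⟩, hiI⟩, rfl⟩
    · rintro ⟨I, ⟨⟨hI, hU⟩, hiI⟩, rfl⟩; exact ⟨⟨I, hI, hiI, rfl⟩, hU⟩
  rw [this, card_image_of_injective _ (cutOf_injective hq)]

/-- Auxiliary (`card_UexC_aSwap_inter`). [folklore] -/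
theorem card_UexC_aSwap_inter (hq : 0 < q) (i : Fin (m + 1)) :
    ((UexC μ (aSwap i * π) ∩ 𝒰).card) = ((Yfam μ 𝒰 π).filter fun y => y i = true).card := by
  rw [card_Yfam_filter]
  have : UexC μ (aSwap i * π) ∩ 𝒰 = ((goodIdx μ 𝒰 π).filter fun I => decide (i ∈ I) = true).image (cutOf π) := by
    ext U
    simp only [mem_inter, mem_UexC_aSwap_mul_iff i π hq, mem_image, mem_filter, goodIdx, mem_powersetCard,
      decide_eq_true_eq, subset_univ, true_and]
    constructor
    · rintro ⟨⟨I, hI, hiI, rfl⟩, hU⟩; exact ⟨I, ⟨⟨hI, hU⟩, hiI⟩, rfl⟩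
    · rintro ⟨I, ⟨⟨hI, hU⟩, hiI⟩, rfl⟩; exact ⟨⟨I, hI, hiI, rfl⟩, hU⟩
  rw [this, card_image_of_injective _ (cutOf_injective hq)]

/-- Auxiliary (`card_Yfam_eq`). [folklore] -/
theorem card_Yfam_eq (i : Fin (m + 1)) :
    (Yfam μ 𝒰 π).card = ((Yfam μ 𝒰 π).filter fun y => y i = false).card + ((Yfam μ 𝒰 π).filter fun y => y i = true).card := by
  rw [← Finset.card_filter_add_card_filter_not (p := fun y => y i = false)]
  congr 2
  ext y
  simp

end family

/-! ### The pointwise argument -/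

section pointwise

variable {μ : ℕ} {ε θ : ℝ} {𝒰 : Finset (Finset (Slot m q))} {ℳ : Finset (Finset (Sym2 (Slot m q)))}
  {Ustar : Finset (Slot m q)} {Mstar : Finset (Sym2 (Slot m q))}

/-- **A compatible `U`-bad index is an `ε/4`-biased coordinate of `Y`.** (Contrapositive of:
unbiased ⇒ `U`-good, using `(1+ε/4)/(1-ε/4) ≤ 1+ε`; and "not small" gives `a₀ > 0`.)
[cite: Rothvoss2017, proof of Lemma 14 with Cor. 12 (PDF pp. 11–12)] -/
theorem biased_of_ubad (hq : 0 < q) (hε : 0 < ε) (hθ : 0 ≤ θ) (π : Equiv.Perm (Slot m q))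
    {i : Fin (m + 1)} (hbad : UBad μ ε θ 𝒰 ℳ (aSwap i * π)) :
    ∃ bb ∈ (univ : Finset Bool),
      (1 + ε / 4) * ((univ : Finset Bool).card) * (((Yfam μ 𝒰 π).filter fun y => y i = bb).card : ℝ) < (Yfam μ 𝒰 π).card ∨
      (1 + ε / 4) * ((Yfam μ 𝒰 π).card : ℝ) < ((univ : Finset Bool).card) * (((Yfam μ 𝒰 π).filter fun y => y i = bb).card : ℝ) := by
  obtain ⟨hns, hng⟩ := hbad
  set a₀ : ℝ := (((Yfam μ 𝒰 π).filter fun y => y i = false).card : ℝ) with ha₀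
  set a₁ : ℝ := (((Yfam μ 𝒰 π).filter fun y => y i = true).card : ℝ) with ha₁
  have h0 : ((Uex3 μ (aSwap i * π) ∩ 𝒰).card : ℝ) = a₀ := by
    rw [ha₀]; exact_mod_cast card_Uex3_aSwap_inter μ 𝒰 π hq i
  have h1 : ((UexC μ (aSwap i * π) ∩ 𝒰).card : ℝ) = a₁ := by
    rw [ha₁]; exact_mod_cast card_UexC_aSwap_inter μ 𝒰 π hq i
  have hY : ((Yfam μ 𝒰 π).card : ℝ) = a₀ + a₁ := by
    rw [ha₀, ha₁]; exact_mod_cast card_Yfam_eq μ 𝒰 π i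
  -- not small: `a₀ > θ · |𝒰ex| ≥ 0`
  have ha₀pos : 0 < a₀ := by
    simp only [Small, not_or, not_le] at hns
    have := hns.2
    rw [h0] at this
    have : (0 : ℝ) ≤ θ * (Uex3 μ (aSwap i * π)).card := by positivity
    linarith
  -- not `U`-good with `a₀ > 0`: one of the two ratio bounds fails
  simp only [UGood, h0, h1, not_and_or, not_lt, not_le] at hng
  have hcard2 : ((univ : Finset Bool).card : ℝ) = 2 := by simp
  simp only [hcard2, hY]
  rcases hng with h | h | h
  · exact absurd ha₀pos (not_lt.2 h)
  · -- `(1+ε) a₁ < a₀`: coordinate `true` is under-represented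
    refine ⟨true, mem_univ _, Or.inl ?_⟩
    rw [← ha₁]
    nlinarith
  · -- `(1+ε) a₀ < a₁`: coordinate `false` is under-represented
    refine ⟨false, mem_univ _, Or.inl ?_⟩
    rw [← ha₀]
    nlinarith

/-- `C(m, μ+1) ≥ 2^m / (m+1)` for `m = 2μ+1`, in logarithmic form. [folklore] -/
theorem log_choose_ge (hm : m = 2 * μ + 1) :
    (m : ℝ) * Real.log 2 - Real.log ((m : ℝ) + 1) ≤ Real.log (Nat.choose m (μ + 1) : ℝ) := by
  have h := two_pow_le_succ_mul_choose_middle μ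
  rw [← hm] at h
  have hpos : (0 : ℝ) < Nat.choose m (μ + 1) := by
    rw [hm]; exact_mod_cast Nat.choose_pos (by omega)
  have hm1 : (0 : ℝ) < (m : ℝ) + 1 := by positivity
  have h' : (2 : ℝ) ^ m ≤ ((m : ℝ) + 1) * Nat.choose m (μ + 1) := by
    have : ((2 ^ m : ℕ) : ℝ) ≤ (((2 * μ + 2) * Nat.choose m (μ + 1) : ℕ) : ℝ) := by exact_mod_cast h
    push_cast at this
    have hm' : (2 * (μ : ℝ) + 2) = (m : ℝ) + 1 := by rw [hm]; push_cast; ring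
    rwa [hm'] at this
  have := Real.log_le_log (by positivity) h'
  rw [Real.log_pow, Real.log_mul hm1.ne' hpos.ne'] at this
  linarith

/-- **Lemma 14, pointwise form.** For every `π`, among the indices `i` with `aSwap i · π`
compatible with `(U*, M*)`, at most a quarter are `U`-bad — given the largeness hypothesis
`hβ : (Real.log 2 + Real.log(m+1) - Real.log θ)/c ≤ (μ+1)/4`. [cite: Rothvoss2017, Lemma 14 (PDF pp. 11–12)] -/
theorem ubad_pointwise (hq : 0 < q) (hm : m = 2 * μ + 1) (hε : 0 < ε) (hθ : 0 < θ)
    (hβ : (Real.log 2 + Real.log ((m : ℝ) + 1) - Real.log θ) / cU ε ≤ ((μ : ℝ) + 1) / 4) (π : Equiv.Perm (Slot m q)) :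
    ((univ.filter fun i : Fin (m + 1) =>
        Compat μ Ustar Mstar (aSwap i * π) ∧ UBad μ ε θ 𝒰 ℳ (aSwap i * π)).card : ℝ) ≤
      (1 / 4) * ((univ.filter fun i : Fin (m + 1) => Compat μ Ustar Mstar (aSwap i * π)).card : ℝ) := by
  -- compatibility after the exchange
  have hcompat : ∀ i, Compat μ Ustar Mstar (aSwap i * π) ↔
      (∃ I : Finset (Fin (m + 1)), I.card = μ + 1 ∧ i ∉ I ∧ Ustar = cutOf π I) ∧ Mstar ∈ Mex3 π := by
    intro i
    rw [Compat, mem_Uex3_aSwap_mul_iff i π hq, Mex3_aSwap_mul]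
  by_cases hP : (∃ I : Finset (Fin (m + 1)), I.card = μ + 1 ∧ Ustar = cutOf π I) ∧ Mstar ∈ Mex3 π
  · obtain ⟨⟨Istar, hIcard, hUI⟩, hMstar⟩ := hP
    -- the compatible indices are exactly those outside `I*`
    have hcomp : (univ.filter fun i : Fin (m + 1) => Compat μ Ustar Mstar (aSwap i * π)) = univ \ Istar := by
      ext i
      simp only [mem_filter, mem_univ, true_and, mem_sdiff, hcompat]
      constructor
      · rintro ⟨⟨I, -, hiI, hI⟩, -⟩
        rwa [cutOf_injective hq (hUI.symm.trans hI)]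
      · intro hi
        exact ⟨⟨Istar, hIcard, hi, hUI⟩, hMstar⟩
    have hcount : ((univ.filter fun i : Fin (m + 1) => Compat μ Ustar Mstar (aSwap i * π)).card : ℝ) = (μ : ℝ) + 1 := by
      rw [hcomp, card_sdiff_of_subset (subset_univ _), card_univ, Fintype.card_fin, hIcard]
      have : m + 1 - (μ + 1) = μ + 1 := by omega
      rw [this]
      push_cast
      ring
    rw [hcount]
    -- the bad compatible indices are biased coordinates
    set B := univ.filter fun i : Fin (m + 1) =>
        Compat μ Ustar Mstar (aSwap i * π) ∧ UBad μ ε θ 𝒰 ℳ (aSwap i * π) with hB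
    rcases B.eq_empty_or_nonempty with hB0 | ⟨i₀, hi₀⟩
    · rw [hB0, card_empty]; push_cast; positivity
    have hi₀' := (mem_filter.1 hi₀).2.2
    -- `Y` is large: `|Y| > θ C(m, μ+1)`
    have hYge : θ * Nat.choose m (μ + 1) < ((Yfam μ 𝒰 π).card : ℝ) := by
      obtain ⟨hns, -⟩ := hi₀'
      simp only [Small, not_or, not_le] at hns
      have h2 := hns.2
      rw [card_Uex3 hq] at h2
      have h3 : ((Uex3 μ (aSwap i₀ * π) ∩ 𝒰).card : ℝ) ≤ (Yfam μ 𝒰 π).card := by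
        rw [card_Uex3_aSwap_inter μ 𝒰 π hq i₀]
        exact_mod_cast card_le_card (filter_subset _ _)
      linarith
    have hYne : (Yfam μ 𝒰 π).Nonempty := by
      rw [← card_pos]
      have : (0 : ℝ) < (Yfam μ 𝒰 π).card := lt_of_le_of_lt (by positivity) hYge
      exact_mod_cast this
    -- the entropy lemma
    have hent := card_biased_mul_le_log (fun _ : Fin (m + 1) => (univ : Finset Bool)) (Yfam μ 𝒰 π)
      (fun y _ => Fintype.mem_piFinset.2 fun _ => mem_univ _) hYne (ε := ε / 4) (by positivity) (q := 2)
      (fun _ => by simp) B (fun i hi => by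
        have hi' := (mem_filter.1 hi).2.2
        obtain ⟨bb, hbb, h⟩ := biased_of_ubad hq hε hθ.le π hi'
        exact ⟨bb, hbb, by simpa using h⟩)
    have hcU : cU ε = (ε / 4 / ((1 + ε / 4) * (2 : ℕ))) ^ 2 / 2 := rfl
    rw [← hcU] at hent
    have hcUpos : 0 < cU ε := by rw [hcU]; positivity
    have hprod : (∏ _i : Fin (m + 1), (((univ : Finset Bool).card : ℕ) : ℝ)) = (2 : ℝ) ^ (m + 1) := by
      simp
    rw [hprod, Real.log_pow] at hent
    -- combine: `|B| c ≤ (m+1) Real.log 2 - Real.log|Y| < (m+1) Real.log 2 - Real.log θ - Real.log C ≤ Real.log 2 + Real.log(m+1) - Real.log θ`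
    have hlogY : Real.log θ + ((m : ℝ) * Real.log 2 - Real.log ((m : ℝ) + 1)) < Real.log ((Yfam μ 𝒰 π).card : ℝ) := by
      have hC := log_choose_ge (μ := μ) hm
      have hpos : (0 : ℝ) < θ * Nat.choose m (μ + 1) := by
        apply mul_pos hθ; rw [hm]; exact_mod_cast Nat.choose_pos (by omega)
      have := Real.log_lt_log hpos hYge
      rw [Real.log_mul hθ.ne' (by rw [hm]; exact_mod_cast (Nat.choose_pos (by omega)).ne')] at this
      linarith
    have hBle : (B.card : ℝ) * cU ε ≤ Real.log 2 + Real.log ((m : ℝ) + 1) - Real.log θ := by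
      have : ((m : ℝ) + 1) * Real.log 2 = (m : ℝ) * Real.log 2 + Real.log 2 := by ring
      push_cast at hent
      linarith
    have hBle' : (B.card : ℝ) ≤ (Real.log 2 + Real.log ((m : ℝ) + 1) - Real.log θ) / cU ε := by
      rw [le_div_iff₀ hcUpos]; exact hBle
    linarith
  · -- no compatible index at all
    have hnone : (univ.filter fun i : Fin (m + 1) => Compat μ Ustar Mstar (aSwap i * π)) = ∅ := by
      rw [filter_eq_empty_iff]
      intro i _ hc
      rw [hcompat] at hc
      obtain ⟨⟨I, hI, -, hUI⟩, hM⟩ := hc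
      exact hP ⟨⟨I, hI, hUI⟩, hM⟩
    have hnone' : (univ.filter fun i : Fin (m + 1) =>
        Compat μ Ustar Mstar (aSwap i * π) ∧ UBad μ ε θ 𝒰 ℳ (aSwap i * π)) = ∅ := by
      rw [filter_eq_empty_iff]
      intro i hi hc
      have : i ∈ (univ.filter fun i : Fin (m + 1) => Compat μ Ustar Mstar (aSwap i * π)) := mem_filter.2 ⟨hi, hc.1⟩
      rw [hnone] at this
      simp at this
    rw [hnone, hnone', card_empty]
    simp

/-- **Lemma 14.** At most a quarter of the partitions compatible with `(U*, M*)` are `U`-bad.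
[cite: Rothvoss2017, Lemma 14 (PDF p. 11)] -/
theorem card_compat_ubad_le (hq : 0 < q) (hm : m = 2 * μ + 1) (hε : 0 < ε) (hθ : 0 < θ)
    (hβ : (Real.log 2 + Real.log ((m : ℝ) + 1) - Real.log θ) / cU ε ≤ ((μ : ℝ) + 1) / 4) :
    ((univ.filter fun π : Equiv.Perm (Slot m q) =>
        Compat μ Ustar Mstar π ∧ UBad μ ε θ 𝒰 ℳ π).card : ℝ) ≤
      (1 / 4) * ((univ.filter fun π : Equiv.Perm (Slot m q) => Compat μ Ustar Mstar π).card : ℝ) := by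
  haveI : Nonempty (Fin (m + 1)) := ⟨0⟩
  exact card_filter_and_le_of_fibres (fun i : Fin (m + 1) => Equiv.mulLeft (aSwap (q := q) i))
    (Compat μ Ustar Mstar) (UBad μ ε θ 𝒰 ℳ) (1 / 4) fun π => ubad_pointwise hq hm hε hθ hβ π

end pointwise

end Literature.Barriers.PneNP

end


/-! ## Part: `TSPExtensionComplexityRothvossMsupH` -/

/-!
# Rothvoß's Lemma 15, I: the product structure `X = Π_j PM(B̃_j) × Π_j PM(A_j)`

Support file for the discharge of `Literature.Barriers.PneNP.Rothvoss2017_tsp` (Rothvoß 2017,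
proof of Lemma 15, PDF p. 12): "Define `X_i := {all perfect matchings on B̃_i}` (`i ≤ m+1`),
`X_{m+i+1} := {all perfect matchings on A_i}` and set `X := X₁ × … × X_{2m+1}`. We abbreviate
`Y := {M ∈ X | M ∪ H ∈ ℳ}`." In the slot model the `2m+1` blocks are `Bfam π` (`A_j`, `B_j`, and
`B̃_{m+1} = (C ∖ V(H)) ∪ (D ∖ V(H))`), and for EVERY exchange `θ' = bswap i₀ h` (or `θ' = 1`):

* `Msup_theta_Hm`: the matchings of `ℳ_all(θ' · π)` containing `H` are exactly `H ∪ N` with `N`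
  a `Bfam π`-block-respecting perfect matching (`MsupH π`, independent of `i₀, h`);
* `isPMOn_CD_theta_iff`: the perfect matchings `F ⊇ H` of the new `C ∪ D` are `H ∪ F_i` with
  `F_i` a perfect matching of the selected block;
* `Mex3_theta_subset`, `card_Mex3_theta_ge`: `ℳex(θ' · π) ⊆ MsupH π` and
  `|ℳex(θ' · π)| · |PM(selected block)| ≥ |MsupH π|` ("`|Y| ≥ 2^{-δm} Π_{j≠i}|X_j| ≥ 2^{-2δm}|X|`").

All [folklore] around the cited proof.
-/

noncomputable section

open scoped Classical

namespace Literature.Barriers.PneNP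

open Finset Slot

variable {m q : ℕ}

/-! ### The block family and the exchanges -/

/-- The `2m+1` blocks off `V(H)`: `A_j` (`inl j`), `B_j` (`inr (castSucc j)`), and
`B̃_{m+1} = (C ∖ V(H)) ∪ (D ∖ V(H))` (`inr (last m)`). [cite: Rothvoss2017, proof of Lemma 15 (PDF p. 12)] -/
def Bfam (π : Equiv.Perm (Slot m q)) : Fin m ⊕ Fin (m + 1) → Finset (Slot m q)
  | Sum.inl j => Ablk π j
  | Sum.inr j => Fin.lastCases (Atil π (Fin.last m) ∪ Drest π) (fun j₀ => Bblk π j₀) j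

/-- Auxiliary (`Bfam_inl`). [folklore] -/
@[simp] theorem Bfam_inl (π : Equiv.Perm (Slot m q)) (j : Fin m) : Bfam π (Sum.inl j) = Ablk π j := rfl
/-- Auxiliary (`Bfam_inr_last`). [folklore] -/
@[simp] theorem Bfam_inr_last (π : Equiv.Perm (Slot m q)) :
    Bfam π (Sum.inr (Fin.last m)) = Atil π (Fin.last m) ∪ Drest π := by
  simp [Bfam]
/-- Auxiliary (`Bfam_inr_castSucc`). [folklore] -/
@[simp] theorem Bfam_inr_castSucc (π : Equiv.Perm (Slot m q)) (j₀ : Fin m) :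
    Bfam π (Sum.inr (Fin.castSucc j₀)) = Bblk π j₀ := by
  simp [Bfam]

/-- The exchange for index `i ≤ m`: `bswap i₀ h` for `i = castSucc i₀`, the identity for `i = m`.
[folklore] -/
def theta (i : Fin (m + 1)) (h : Equiv.Perm (Bool × Fin q)) : Equiv.Perm (Slot m q) :=
  Fin.lastCases 1 (fun i₀ => bswap i₀ h) i

/-- Auxiliary (`theta_last`). [folklore] -/
@[simp] theorem theta_last (h : Equiv.Perm (Bool × Fin q)) : theta (Fin.last m) h = (1 : Equiv.Perm (Slot m q)) := by
  simp [theta]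
/-- Auxiliary (`theta_castSucc`). [folklore] -/
@[simp] theorem theta_castSucc (i₀ : Fin m) (h : Equiv.Perm (Bool × Fin q)) :
    (theta (Fin.castSucc i₀) h : Equiv.Perm (Slot m q)) = bswap i₀ h := by
  simp [theta]

/-- The block of a slot off `c ∪ d`. [folklore] -/
def Slot.bfamIdx : Slot m q → Option (Fin m ⊕ Fin (m + 1))
  | a j _ => some (Fin.lastCases (Sum.inr (Fin.last m)) (fun j₀ => Sum.inl j₀) j)
  | c _ => none
  | d _ => none
  | dr _ => some (Sum.inr (Fin.last m))
  | b j _ _ => some (Sum.inr (Fin.castSucc j))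

/-- Auxiliary (`mem_Bfam_iff`). [folklore] -/
theorem mem_Bfam_iff {π : Equiv.Perm (Slot m q)} {r : Fin m ⊕ Fin (m + 1)} {v : Slot m q} :
    v ∈ Bfam π r ↔ bfamIdx (π v) = some r := by
  rcases r with j | j
  · rw [Bfam_inl, Ablk_eq_Atil, mem_Atil]
    rcases hv : π v with ⟨j', x⟩ | t | t | x | ⟨j', sd, x⟩
    · induction j' using Fin.lastCases with
      | last => simp [bfamIdx, (Fin.castSucc_lt_last j).ne']
      | cast j₁ => simp [bfamIdx]
    · simp [bfamIdx]
    · simp [bfamIdx]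
    · simp [bfamIdx]
    · simp [bfamIdx]
  · induction j using Fin.lastCases with
    | last =>
      rw [Bfam_inr_last, mem_union, mem_Atil, mem_Drest]
      rcases hv : π v with ⟨j', x⟩ | t | t | x | ⟨j', sd, x⟩
      · induction j' using Fin.lastCases with
        | last => simp [bfamIdx]
        | cast j₁ => simp [bfamIdx, (Fin.castSucc_lt_last j₁).ne]
      · simp [bfamIdx]
      · simp [bfamIdx]
      · simp [bfamIdx]
      · simp [bfamIdx, (Fin.castSucc_lt_last j').ne]
    | cast j₀ =>
      rw [Bfam_inr_castSucc, mem_Bblk]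
      rcases hv : π v with ⟨j', x⟩ | t | t | x | ⟨j', sd, x⟩
      · induction j' using Fin.lastCases with
        | last => simp [bfamIdx, (Fin.castSucc_lt_last j₀).ne']
        | cast j₁ => simp [bfamIdx]
      · simp [bfamIdx]
      · simp [bfamIdx]
      · simp [bfamIdx, (Fin.castSucc_lt_last j₀).ne']
      · simp [bfamIdx, Fin.castSucc_inj, eq_comm]

/-- Auxiliary (`Bfam_disjoint`). [folklore] -/
theorem Bfam_disjoint (π : Equiv.Perm (Slot m q)) : ∀ r r', r ≠ r' → Disjoint (Bfam π r) (Bfam π r') := by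
  intro r r' hne
  rw [disjoint_left]
  intro v hv hv'
  rw [mem_Bfam_iff] at hv hv'
  rw [hv] at hv'
  exact hne (Option.some.inj hv')

/-- Off `V(H)`, every vertex lies in a block of `Bfam`. [folklore] -/
theorem biUnion_Bfam (π : Equiv.Perm (Slot m q)) : univ.biUnion (Bfam π) = univ \ (cset π ∪ dset π) := by
  ext v
  simp only [mem_biUnion, mem_univ, true_and, mem_sdiff, mem_union, mem_cset, mem_dset, mem_Bfam_iff]
  rcases hv : π v with ⟨j, x⟩ | t | t | x | ⟨j, sd, x⟩ <;> simp [bfamIdx]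

/-! ### Roles after the exchange -/

/-- The index of the block of a vertex off `V(H)`, as a function. [folklore] -/
theorem exists_bfamIdx {π : Equiv.Perm (Slot m q)} {v : Slot m q} (hv : v ∉ cset π ∪ dset π) :
    ∃ r, bfamIdx (π v) = some r := by
  have : v ∈ univ.biUnion (Bfam π) := by rw [biUnion_Bfam]; exact mem_sdiff.2 ⟨mem_univ _, hv⟩
  obtain ⟨r, -, hr⟩ := mem_biUnion.1 this
  exact ⟨r, mem_Bfam_iff.1 hr⟩

/-- The role, after the exchange `theta i h`, of the block with index `r`. [folklore] -/
def roleOfIdx (i : Fin (m + 1)) : Fin m ⊕ Fin (m + 1) → Role m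
  | Sum.inl j => Role.A j
  | Sum.inr j => if j = i then Role.CD else
      Fin.lastCases (Fin.lastCases Role.CD (fun i₀ => Role.B i₀) i) (fun j₀ => Role.B j₀) j

/-- Auxiliary (`roleOfIdx_inr_of_ne_of_ne_last`). [folklore] -/
theorem roleOfIdx_inr_of_ne_of_ne_last (i : Fin (m + 1)) {j : Fin (m + 1)} (hji : j ≠ i) (j₀ : Fin m)
    (hj : j = Fin.castSucc j₀) : roleOfIdx i (Sum.inr j) = Role.B j₀ := by
  subst hj; simp [roleOfIdx, hji]

/-- Auxiliary (`roleOfIdx_inr_last_of_ne`). [folklore] -/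
theorem roleOfIdx_inr_last_of_ne (i₀ : Fin m) :
    roleOfIdx (Fin.castSucc i₀) (Sum.inr (Fin.last m)) = Role.B i₀ := by
  simp [roleOfIdx, (Fin.castSucc_lt_last i₀).ne']

/-- Auxiliary (`roleOfIdx_inr_self`). [folklore] -/
theorem roleOfIdx_inr_self (i : Fin (m + 1)) : roleOfIdx i (Sum.inr i) = Role.CD := by
  simp [roleOfIdx]

/-- Auxiliary (`roleOfIdx_injective`). [folklore] -/
theorem roleOfIdx_injective (i : Fin (m + 1)) : Function.Injective (roleOfIdx (m := m) i) := by
  intro r r' hrr'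
  rcases r with j | j <;> rcases r' with j' | j'
  · simpa [roleOfIdx] using hrr'
  · exfalso
    simp only [roleOfIdx] at hrr'
    split_ifs at hrr' with h1
    induction j' using Fin.lastCases with
    | last =>
      induction i using Fin.lastCases with
      | last => exact h1 rfl
      | cast i₀ => simp at hrr'
    | cast j₀ => simp at hrr'
  · exfalso
    simp only [roleOfIdx] at hrr'
    split_ifs at hrr' with h1
    induction j using Fin.lastCases with
    | last =>
      induction i using Fin.lastCases with
      | last => exact h1 rfl
      | cast i₀ => simp at hrr'
    | cast j₀ => simp at hrr'
  · simp only [roleOfIdx] at hrr'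
    by_cases h1 : j = i <;> by_cases h2 : j' = i
    · rw [h1, h2]
    · exfalso
      simp only [h1, ↓reduceIte, h2] at hrr'
      induction j' using Fin.lastCases with
      | last =>
        induction i using Fin.lastCases with
        | last => exact h2 rfl
        | cast i₀ => simp at hrr'
      | cast j₀ => simp at hrr'
    · exfalso
      simp only [h1, ↓reduceIte, h2] at hrr'
      induction j using Fin.lastCases with
      | last =>
        induction i using Fin.lastCases with
        | last => exact h1 rfl
        | cast i₀ => simp at hrr'
      | cast j₀ => simp at hrr'
    · simp only [h1, ↓reduceIte, h2] at hrr'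
      induction j using Fin.lastCases with
      | last =>
        induction j' using Fin.lastCases with
        | last => rfl
        | cast j₀' =>
          exfalso
          induction i using Fin.lastCases with
          | last => exact h1 rfl
          | cast i₀ =>
            simp only [Fin.lastCases_last, Fin.lastCases_castSucc, Role.B.injEq] at hrr'
            exact h2 (by rw [hrr'])
      | cast j₀ =>
        induction j' using Fin.lastCases with
        | last =>
          exfalso
          induction i using Fin.lastCases with
          | last => exact h2 rfl
          | cast i₀ =>
            simp only [Fin.lastCases_last, Fin.lastCases_castSucc, Role.B.injEq] at hrr'
            exact h1 (by rw [hrr'])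
        | cast j₀' =>
          simp only [Fin.lastCases_castSucc, Role.B.injEq] at hrr'
          rw [hrr']

/-- **The role of a vertex off `V(H)` after the exchange is `roleOfIdx` of its block.** [folklore] -/
theorem role_theta_mul (i : Fin (m + 1)) (h : Equiv.Perm (Bool × Fin q)) (π : Equiv.Perm (Slot m q))
    {v : Slot m q} {r : Fin m ⊕ Fin (m + 1)} (hr : bfamIdx (π v) = some r) :
    role ((theta i h * π) v) = roleOfIdx i r := by
  rw [Equiv.Perm.mul_apply]
  induction i using Fin.lastCases with
  | last =>
    rw [theta_last, Equiv.Perm.one_apply]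
    rcases hv : π v with ⟨j, x⟩ | t | t | x | ⟨j, sd, x⟩ <;> rw [hv] at hr <;>
      simp only [bfamIdx, Option.some.injEq, reduceCtorEq] at hr
    · subst hr
      induction j using Fin.lastCases with
      | last => simp [roleOfIdx, role_a_last]
      | cast j₀ => simp [roleOfIdx, role_a_castSucc]
    · subst hr; simp [roleOfIdx, role]
    · subst hr; simp [roleOfIdx, role, (Fin.castSucc_lt_last j).ne]
  | cast i₀ =>
    rw [theta_castSucc, bswap_apply, role_bswapMap]
    rcases hv : π v with ⟨j, x⟩ | t | t | x | ⟨j, sd, x⟩ <;> rw [hv] at hr <;>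
      simp only [bfamIdx, Option.some.injEq, reduceCtorEq] at hr
    · subst hr
      induction j using Fin.lastCases with
      | last => simp [roleOfIdx_inr_last_of_ne]
      | cast j₀ => simp [roleOfIdx, role_a_castSucc, (Fin.castSucc_lt_last j₀).ne]
    · subst hr; simp [roleOfIdx_inr_last_of_ne]
    · subst hr
      by_cases hj : j = i₀
      · subst hj; simp [roleOfIdx_inr_self]
      · have : Fin.castSucc j ≠ Fin.castSucc i₀ := fun h' => hj (Fin.castSucc_injective _ h')
        simp [hj, roleOfIdx_inr_of_ne_of_ne_last _ this j rfl, role]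

/-- Auxiliary (`Hm_theta_mul`). [folklore] -/
theorem Hm_theta_mul (i : Fin (m + 1)) (h : Equiv.Perm (Bool × Fin q)) (π : Equiv.Perm (Slot m q)) :
    Hm (theta i h * π) = Hm π := by
  induction i using Fin.lastCases with
  | last => rw [theta_last, one_mul]
  | cast i₀ => rw [theta_castSucc, Hm_bswap_mul]

/-- Auxiliary (`cset_theta_mul`). [folklore] -/
theorem cset_theta_mul (i : Fin (m + 1)) (h : Equiv.Perm (Bool × Fin q)) (π : Equiv.Perm (Slot m q)) :
    cset (theta i h * π) = cset π := by
  induction i using Fin.lastCases with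
  | last => rw [theta_last, one_mul]
  | cast i₀ => rw [theta_castSucc, cset_bswap_mul]

/-- Auxiliary (`dset_theta_mul`). [folklore] -/
theorem dset_theta_mul (i : Fin (m + 1)) (h : Equiv.Perm (Bool × Fin q)) (π : Equiv.Perm (Slot m q)) :
    dset (theta i h * π) = dset π := by
  induction i using Fin.lastCases with
  | last => rw [theta_last, one_mul]
  | cast i₀ => rw [theta_castSucc, dset_bswap_mul]

/-! ### `Msup (θ' · π) H = MsupH π` -/

/-- `H ∪ N` with `N` a `Bfam π`-block-respecting perfect matching off `V(H)` — the set `X` of the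
cited proof, realised as matchings. [cite: Rothvoss2017, proof of Lemma 15 (PDF p. 12)] -/
def MsupH (π : Equiv.Perm (Slot m q)) : Finset (Finset (Sym2 (Slot m q))) :=
  univ.filter fun M => Hm π ⊆ M ∧ IsPMOn (univ \ (cset π ∪ dset π)) (M \ Hm π) ∧
    ∀ e ∈ M \ Hm π, ∃ r, e ∈ (Bfam π r).sym2

/-- `M ⊇ H` is a perfect matching of everything iff `M ∖ H` is one of `V ∖ V(H)`. [folklore] -/
theorem isPMOn_univ_iff_sdiff (π : Equiv.Perm (Slot m q)) {M : Finset (Sym2 (Slot m q))} (hHM : Hm π ⊆ M) :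
    IsPMOn univ M ↔ IsPMOn (univ \ (cset π ∪ dset π)) (M \ Hm π) := by
  have hU : (univ : Finset (Slot m q)) = (cset π ∪ dset π) ∪ (univ \ (cset π ∪ dset π)) :=
    (union_sdiff_of_subset (subset_univ _)).symm
  constructor
  · intro h
    rw [hU] at h
    exact h.sdiff disjoint_sdiff (isPMOn_Hm π) hHM
  · intro h
    rw [hU, ← union_sdiff_of_subset hHM]
    exact (isPMOn_Hm π).union h disjoint_sdiff

/-- **For every exchange `θ'`, the members of `ℳ_all(θ' · π)` containing `H` form `MsupH π`.**
[cite: Rothvoss2017, proof of Lemma 15 (PDF p. 12)] -/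
theorem Msup_theta_Hm (i : Fin (m + 1)) (h : Equiv.Perm (Bool × Fin q)) (π : Equiv.Perm (Slot m q)) :
    Msup (theta i h * π) (Hm π) = MsupH π := by
  ext M
  rw [Msup, mem_filter, MallP, mem_filter, mem_perfectMatchings, MsupH, mem_filter]
  simp only [mem_univ, true_and]
  constructor
  · rintro ⟨⟨hPM, hsame⟩, hHM⟩
    have hN := (isPMOn_univ_iff_sdiff π hHM).1 hPM
    refine ⟨hHM, hN, fun e he => ?_⟩
    induction e using Sym2.ind with
    | h u v =>
      have hu : u ∉ cset π ∪ dset π := (mem_sdiff.1 (hN.mem_of_mem he (Sym2.mem_mk_left u v))).2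
      have hv : v ∉ cset π ∪ dset π := (mem_sdiff.1 (hN.mem_of_mem he (Sym2.mem_mk_right u v))).2
      obtain ⟨r, hr⟩ := exists_bfamIdx hu
      obtain ⟨r', hr'⟩ := exists_bfamIdx hv
      have hrole := (sameRole_mk _ u v).1 (hsame _ (mem_sdiff.1 he).1)
      rw [role_theta_mul i h π hr, role_theta_mul i h π hr'] at hrole
      have hrr' := roleOfIdx_injective i hrole
      subst hrr'
      exact ⟨r, mk_mem_sym2_iff.2 ⟨mem_Bfam_iff.2 hr, mem_Bfam_iff.2 hr'⟩⟩
  · rintro ⟨hHM, hN, hresp⟩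
    refine ⟨⟨(isPMOn_univ_iff_sdiff π hHM).2 hN, fun e he => ?_⟩, hHM⟩
    induction e using Sym2.ind with
    | h u v =>
      rw [sameRole_mk]
      by_cases heH : s(u, v) ∈ Hm π
      · -- edges of `H` join `c` to `d`: both of role `CD`
        rw [← Hm_theta_mul i h π] at heH
        have hu := (isPMOn_Hm (theta i h * π)).mem_of_mem heH (Sym2.mem_mk_left u v)
        have hv := (isPMOn_Hm (theta i h * π)).mem_of_mem heH (Sym2.mem_mk_right u v)
        rw [mem_union, mem_cset, mem_dset] at hu hv
        have key : ∀ w : Slot m q, ((∃ t, (theta i h * π) w = c t) ∨ ∃ t, (theta i h * π) w = d t) →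
            role ((theta i h * π) w) = Role.CD := by
          rintro w (⟨t, ht⟩ | ⟨t, ht⟩) <;> rw [ht] <;> rfl
        rw [key u hu, key v hv]
      · obtain ⟨r, hr⟩ := hresp _ (mem_sdiff.2 ⟨he, heH⟩)
        rw [mk_mem_sym2_iff, mem_Bfam_iff, mem_Bfam_iff] at hr
        rw [role_theta_mul i h π hr.1, role_theta_mul i h π hr.2]

/-! ### The new `C ∪ D` and its perfect matchings containing `H` -/

/-- Auxiliary (`disjoint_VH_Bfam`). [folklore] -/
theorem disjoint_VH_Bfam (π : Equiv.Perm (Slot m q)) (r : Fin m ⊕ Fin (m + 1)) :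
    Disjoint (cset π ∪ dset π) (Bfam π r) := by
  rw [disjoint_right]
  intro v hv
  have : v ∈ univ.biUnion (Bfam π) := mem_biUnion.2 ⟨r, mem_univ _, hv⟩
  rw [biUnion_Bfam] at this
  exact (mem_sdiff.1 this).2

/-- After the exchange `theta i h`, `C ∪ D = V(H) ∪ B̃_i`. [folklore] -/
theorem CD_theta_mul (i : Fin (m + 1)) (h : Equiv.Perm (Bool × Fin q)) (π : Equiv.Perm (Slot m q)) :
    Cset (theta i h * π) ∪ Dset (theta i h * π) = (cset π ∪ dset π) ∪ Bfam π (Sum.inr i) := by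
  induction i using Fin.lastCases with
  | last =>
    rw [theta_last, one_mul, Bfam_inr_last, CD_decomp]
    rfl
  | cast i₀ =>
    rw [theta_castSucc, Bfam_inr_castSucc, Cset_bswap_mul, Dset_eq_dset_union_Drest, dset_bswap_mul,
      Drest_bswap_mul, ← halfC_union_halfD i₀ h π]
    ext v; simp only [mem_union]; tauto

/-- The perfect matchings `F ⊇ H` of the new `C ∪ D` are `H ∪ F_i`, `F_i` a perfect matching of
`B̃_i`. [folklore] -/
theorem isPMOn_CD_theta_iff (i : Fin (m + 1)) (h : Equiv.Perm (Bool × Fin q)) (π : Equiv.Perm (Slot m q))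
    {F : Finset (Sym2 (Slot m q))} (hHF : Hm π ⊆ F) :
    IsPMOn (Cset (theta i h * π) ∪ Dset (theta i h * π)) F ↔ IsPMOn (Bfam π (Sum.inr i)) (F \ Hm π) := by
  rw [CD_theta_mul]
  constructor
  · intro hF
    exact hF.sdiff (disjoint_VH_Bfam π _) (isPMOn_Hm π) hHF
  · intro hF
    rw [← union_sdiff_of_subset hHF]
    exact (isPMOn_Hm π).union hF (disjoint_VH_Bfam π _)

/-- For `F ⊇ H`: `Msup (θ' · π) F = {M ∈ MsupH π : F ⊆ M}`. [folklore] -/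
theorem Msup_theta_of_Hm_subset (i : Fin (m + 1)) (h : Equiv.Perm (Bool × Fin q)) (π : Equiv.Perm (Slot m q))
    {F : Finset (Sym2 (Slot m q))} (hHF : Hm π ⊆ F) :
    Msup (theta i h * π) F = (MsupH π).filter fun M => F ⊆ M := by
  rw [← Msup_theta_Hm i h π, Msup, Msup, filter_filter]
  congr 1
  ext M
  exact ⟨fun hFM => ⟨hHF.trans hFM, hFM⟩, fun h => h.2⟩

/-! ### `MsupH π` as the product `X` -/

/-- `X = Π_r PM(Bfam π r)`. [cite: Rothvoss2017, proof of Lemma 15 (PDF p. 12)] -/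
def Xfam (π : Equiv.Perm (Slot m q)) : Finset (Fin m ⊕ Fin (m + 1) → Finset (Sym2 (Slot m q))) :=
  Fintype.piFinset fun r => perfectMatchings (Bfam π r)

/-- Glue a choice of block matchings to `H`. [folklore] -/
def glueH (π : Equiv.Perm (Slot m q)) (g : Fin m ⊕ Fin (m + 1) → Finset (Sym2 (Slot m q))) :
    Finset (Sym2 (Slot m q)) := Hm π ∪ univ.biUnion g

/-- Auxiliary (`Hm_disjoint_biUnion`). [folklore] -/
theorem Hm_disjoint_biUnion {π : Equiv.Perm (Slot m q)} {g : Fin m ⊕ Fin (m + 1) → Finset (Sym2 (Slot m q))}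
    (hg : g ∈ Xfam π) : Disjoint (Hm π) (univ.biUnion g) := by
  rw [disjoint_left]
  intro e he he'
  obtain ⟨r, -, hr⟩ := mem_biUnion.1 he'
  have hgr : IsPMOn (Bfam π r) (g r) := mem_perfectMatchings.1 (Fintype.mem_piFinset.1 hg r)
  induction e using Sym2.ind with
  | h u v =>
    have hu := (isPMOn_Hm π).mem_of_mem he (Sym2.mem_mk_left u v)
    have hu' := hgr.mem_of_mem hr (Sym2.mem_mk_left u v)
    exact disjoint_left.1 (disjoint_VH_Bfam π r) hu hu'

/-- Auxiliary (`glueH_sdiff`). [folklore] -/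
theorem glueH_sdiff {π : Equiv.Perm (Slot m q)} {g : Fin m ⊕ Fin (m + 1) → Finset (Sym2 (Slot m q))}
    (hg : g ∈ Xfam π) : glueH π g \ Hm π = univ.biUnion g := by
  rw [glueH, union_sdiff_cancel_left (Hm_disjoint_biUnion hg)]

/-- `glueH` maps `X` into `MsupH π`, with the blocks recovered by filtering. [folklore] -/
theorem glueH_mem {π : Equiv.Perm (Slot m q)} {g : Fin m ⊕ Fin (m + 1) → Finset (Sym2 (Slot m q))}
    (hg : g ∈ Xfam π) :
    glueH π g ∈ MsupH π ∧ (fun r => (glueH π g \ Hm π).filter fun e => e ∈ (Bfam π r).sym2) = g := by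
  obtain ⟨⟨hPM, hresp⟩, hrec⟩ := (blockPM_bij (Bfam π) (Bfam_disjoint π)).1 g hg
  rw [glueH_sdiff hg]
  refine ⟨?_, hrec⟩
  rw [MsupH, mem_filter, glueH_sdiff hg, ← biUnion_Bfam]
  exact ⟨mem_univ _, subset_union_left, hPM, hresp⟩

/-- Conversely every member of `MsupH π` is glued from its blocks. [folklore] -/
theorem mem_MsupH_glue {π : Equiv.Perm (Slot m q)} {M : Finset (Sym2 (Slot m q))} (hM : M ∈ MsupH π) :
    (fun r => (M \ Hm π).filter fun e => e ∈ (Bfam π r).sym2) ∈ Xfam π ∧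
      glueH π (fun r => (M \ Hm π).filter fun e => e ∈ (Bfam π r).sym2) = M := by
  rw [MsupH, mem_filter] at hM
  obtain ⟨-, hHM, hN, hresp⟩ := hM
  rw [← biUnion_Bfam] at hN
  obtain ⟨hmem, hglue⟩ := (blockPM_bij (Bfam π) (Bfam_disjoint π)).2 (M \ Hm π) hN hresp
  refine ⟨hmem, ?_⟩
  rw [glueH, hglue, union_sdiff_of_subset hHM]

/-- Auxiliary (`glueH_injOn`). [folklore] -/
theorem glueH_injOn (π : Equiv.Perm (Slot m q)) : Set.InjOn (glueH π) (Xfam π : Set _) := by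
  intro g hg g' hg' hgg'
  have h1 := (glueH_mem (mem_coe.1 hg)).2
  have h2 := (glueH_mem (mem_coe.1 hg')).2
  rw [← h1, ← h2, hgg']

/-- `MsupH π = glueH '' X`. [folklore] -/
theorem MsupH_eq_image (π : Equiv.Perm (Slot m q)) : MsupH π = (Xfam π).image (glueH π) := by
  ext M
  rw [mem_image]
  constructor
  · intro hM
    obtain ⟨hmem, hglue⟩ := mem_MsupH_glue hM
    exact ⟨_, hmem, hglue⟩
  · rintro ⟨g, hg, rfl⟩
    exact (glueH_mem hg).1

/-- Counting through the product: `#{M ∈ MsupH : p M} = #{g ∈ X : p (glueH g)}`. [folklore] -/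
theorem card_MsupH_filter (π : Equiv.Perm (Slot m q)) (p : Finset (Sym2 (Slot m q)) → Prop) [DecidablePred p] :
    ((MsupH π).filter p).card = ((Xfam π).filter fun g => p (glueH π g)).card := by
  rw [MsupH_eq_image, filter_image, card_image_of_injOn]
  exact (glueH_injOn π).mono (coe_subset.2 (filter_subset _ _))

/-- For `g ∈ X` and a perfect matching `F_i` of `B̃_i`: `F_i ⊆ glueH g ↔ g i = F_i`. [folklore] -/
theorem subset_glueH_iff {π : Equiv.Perm (Slot m q)} {g : Fin m ⊕ Fin (m + 1) → Finset (Sym2 (Slot m q))}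
    (hg : g ∈ Xfam π) {r : Fin m ⊕ Fin (m + 1)} {Fi : Finset (Sym2 (Slot m q))}
    (hFi : IsPMOn (Bfam π r) Fi) : Fi ⊆ glueH π g ↔ g r = Fi := by
  have hgr : IsPMOn (Bfam π r) (g r) := mem_perfectMatchings.1 (Fintype.mem_piFinset.1 hg r)
  constructor
  · intro hsub
    -- `Fi ⊆ (glue \ H) ∩ E(B̃_r) = g r`, and both are perfect matchings of `B̃_r`
    have hrec := congrFun (glueH_mem hg).2 r
    have hFi' : Fi ⊆ g r := by
      intro e he
      rw [← hrec, mem_filter, mem_sdiff]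
      refine ⟨⟨hsub he, fun heH => ?_⟩, hFi.subset_sym2 he⟩
      induction e using Sym2.ind with
      | h u v =>
        exact disjoint_left.1 (disjoint_VH_Bfam π r) ((isPMOn_Hm π).mem_of_mem heH (Sym2.mem_mk_left u v))
          (hFi.mem_of_mem he (Sym2.mem_mk_left u v))
    -- a perfect matching contained in another one of the same set is equal to it
    symm
    apply Subset.antisymm hFi'
    intro e he
    induction e using Sym2.ind with
    | h u v =>
      obtain ⟨f, hf, huf⟩ := hFi.exists_mem (hgr.mem_of_mem he (Sym2.mem_mk_left u v))
      rw [hgr.unique he (hFi' hf) (Sym2.mem_mk_left u v) huf]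
      exact hf
  · rintro rfl
    intro e he
    exact mem_union_right _ (mem_biUnion.2 ⟨r, mem_univ _, he⟩)

/-- **`ℳex(θ' · π) ⊆ MsupH π`** (the fine blocks refine `Bfam`). [folklore] -/
theorem Mex3_theta_subset (i : Fin (m + 1)) (h : Equiv.Perm (Bool × Fin q)) (π : Equiv.Perm (Slot m q)) :
    Mex3 (theta i h * π) ⊆ MsupH π := by
  intro M hM
  have hM' : M ∈ Msup (theta i h * π) (Hm π) := by
    rw [Msup, mem_filter]
    rw [Mex3, mem_filter] at hM
    refine ⟨hM.1, ?_⟩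
    rw [← Hm_theta_mul i h π, ← hM.2]
    exact filter_subset _ _
  rwa [Msup_theta_Hm] at hM'

end Literature.Barriers.PneNP

end


/-! ## Part: `TSPExtensionComplexityRothvossMBad` -/

/-!
# Rothvoß's Lemma 15: few compatible partitions are `M`-bad

Support file for the discharge of `Literature.Barriers.PneNP.Rothvoss2017_tsp` (Rothvoß 2017,
Lemma 15, PDF p. 12). With `X = Π_r PM(B̃_r)` and `Y = {x ∈ X : H ∪ x ∈ ℳ}` (`…RothvossMsupH.lean`):
for the exchanged partition `θ'_{i,h} · π`,

* `M`-goodness is EXACTLY "`Y ≠ ∅` and coordinate `i` of `Y` is `ε`-unbiased" (`mbad_biased`: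
  not `M`-good and `Y ≠ ∅` ⇒ biased), since `p(H) = |Y|/|X|` and `p(H ∪ F_i) = |{y ∈ Y : y_i = F_i}| /
  |{x ∈ X : x_i = F_i}|`;
* "not small" gives `|Y| > θ |ℳex| ≥ θ |X| / Q` (`card_Y_gt_of_not_small`), `Q = Q(q)` a bound
  on `|PM(B̃_i)|`;
* hence, for fixed `h`, the indices `i` that are compatible, not small and not `M`-good number
  at most `(Real.log Q - Real.log θ)/c` (`mbad_count_le`, entropy lemma `card_biased_mul_le_log`);
* for every `i < m` SOME `h` makes `θ'_{i,h} · π` compatible with `(U*, M*)` when `π` itself is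
  (`exists_compat_theta`), so that averaging over the family `(i, h)` with
  `card_filter_and_le_of_fibres` gives **Lemma 15**: at most a quarter of the compatible
  partitions are `M`-bad (`card_compat_mbad_le`), for `m` large (hypothesis `hβ`).

Sources: [Rothvoss2017] Lemma 15 and its proof (PDF p. 12), Cor. 12 (PDF p. 11).
-/

noncomputable section

open scoped Classical

namespace Literature.Barriers.PneNP

open Finset Slot

variable {m q : ℕ}

/-! ### The halves of the selected block -/

/-- `|B̃_i| = 2q`. [folklore] -/
theorem card_Bfam_inr (π : Equiv.Perm (Slot m q)) (i : Fin (m + 1)) : (Bfam π (Sum.inr i)).card = 2 * q := by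
  induction i using Fin.lastCases with
  | last =>
    have hd : Disjoint (Atil π (Fin.last m)) (Drest π) :=
      fineP_disjoint π (Sum.inl (Fin.last m)) (Sum.inr (Sum.inl ())) (by simp)
    rw [Bfam_inr_last, card_union_of_disjoint hd, card_Atil]
    rw [show (Drest π).card = q from by rw [Drest, card_pull, card_drSlots]]
    ring
  | cast i₀ => rw [Bfam_inr_castSucc, Bblk, card_pull, card_bSlots]

section halves

variable (i : Fin (m + 1)) (h : Equiv.Perm (Bool × Fin q)) (π : Equiv.Perm (Slot m q))

/-- The new `C ∖ V(H)`. [folklore] -/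
def Chalf : Finset (Slot m q) := Atil (theta i h * π) (Fin.last m)
/-- The new `D ∖ V(H)`. [folklore] -/
def Dhalf : Finset (Slot m q) := Drest (theta i h * π)

/-- Auxiliary (`card_Chalf`). [folklore] -/
theorem card_Chalf : (Chalf i h π).card = q := card_Atil _ _
/-- Auxiliary (`card_Dhalf`). [folklore] -/
theorem card_Dhalf : (Dhalf i h π).card = q := by rw [Dhalf, Drest, card_pull, card_drSlots]

/-- Auxiliary (`Chalf_union_Dhalf`). [folklore] -/
theorem Chalf_union_Dhalf : Chalf i h π ∪ Dhalf i h π = Bfam π (Sum.inr i) := by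
  induction i using Fin.lastCases with
  | last => rw [Chalf, Dhalf, theta_last, one_mul, Bfam_inr_last]
  | cast i₀ => rw [Chalf, Dhalf, theta_castSucc, Crest_bswap_mul, Drest_bswap_mul, halfC_union_halfD, Bfam_inr_castSucc]

/-- Auxiliary (`disjoint_Chalf_Dhalf`). [folklore] -/
theorem disjoint_Chalf_Dhalf : Disjoint (Chalf i h π) (Dhalf i h π) :=
  fineP_disjoint (theta i h * π) (Sum.inl (Fin.last m)) (Sum.inr (Sum.inl ())) (by simp)

/-- Every block of `Bfam π` other than `B̃_i` is inside a fine block of `θ' · π`. [folklore] -/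
theorem Bfam_subset_fineP {r : Fin m ⊕ Fin (m + 1)} (hr : r ≠ Sum.inr i) :
    ∃ r', Bfam π r ⊆ fineP (theta i h * π) r' := by
  induction i using Fin.lastCases with
  | last =>
    rw [theta_last, one_mul]
    rcases r with j | j
    · exact ⟨Sum.inl (Fin.castSucc j), by rw [Bfam_inl, Ablk_eq_Atil]; rfl⟩
    · induction j using Fin.lastCases with
      | last => exact absurd rfl hr
      | cast j₀ => exact ⟨Sum.inr (Sum.inr j₀), by rw [Bfam_inr_castSucc]; rfl⟩
  | cast i₀ =>
    rw [theta_castSucc]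
    rcases r with j | j
    · refine ⟨Sum.inl (Fin.castSucc j), ?_⟩
      rw [Bfam_inl, Ablk_eq_Atil]
      show Atil π _ ⊆ Atil (bswap i₀ h * π) _
      rw [Atil_bswap_mul_of_ne _ _ _ (Fin.castSucc_lt_last j).ne]
    · induction j using Fin.lastCases with
      | last =>
        refine ⟨Sum.inr (Sum.inr i₀), ?_⟩
        rw [Bfam_inr_last]
        show _ ⊆ Bblk (bswap i₀ h * π) i₀
        rw [Bblk_bswap_mul_self]
      | cast j₀ =>
        have hj : j₀ ≠ i₀ := fun h' => hr (by rw [h'])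
        refine ⟨Sum.inr (Sum.inr j₀), ?_⟩
        rw [Bfam_inr_castSucc]
        show _ ⊆ Bblk (bswap i₀ h * π) j₀
        rw [Bblk_bswap_mul_of_ne _ _ _ hj]

/-- A reference non-crossing perfect matching of `B̃_i`: a perfect matching of each half. [folklore] -/
theorem exists_ncPM (hqe : Even q) :
    ∃ NC ND, IsPMOn (Chalf i h π) NC ∧ IsPMOn (Dhalf i h π) ND := by
  obtain ⟨NC, hNC⟩ := exists_isPMOn_of_even _ (Chalf i h π) rfl (by rw [card_Chalf]; exact hqe)
  obtain ⟨ND, hND⟩ := exists_isPMOn_of_even _ (Dhalf i h π) rfl (by rw [card_Dhalf]; exact hqe)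
  exact ⟨NC, ND, hNC, hND⟩

/-- **The fibre of `X` over a non-crossing `F₀` glues into `ℳex(θ' · π)`.** [folklore] -/
theorem glueH_mem_Mex3 {g : Fin m ⊕ Fin (m + 1) → Finset (Sym2 (Slot m q))} (hg : g ∈ Xfam π)
    {NC ND : Finset (Sym2 (Slot m q))} (hNC : IsPMOn (Chalf i h π) NC) (hND : IsPMOn (Dhalf i h π) ND)
    (hgi : g (Sum.inr i) = NC ∪ ND) : glueH π g ∈ Mex3 (theta i h * π) := by
  rw [mem_Mex3_iff, Hm_theta_mul, glueH_sdiff hg, biUnion_fineP, cset_theta_mul, dset_theta_mul, ← biUnion_Bfam]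
  obtain ⟨⟨hPM, hresp⟩, -⟩ := (blockPM_bij (Bfam π) (Bfam_disjoint π)).1 g hg
  refine ⟨subset_union_left, hPM, fun e he => ?_⟩
  obtain ⟨r, -, hr⟩ := mem_biUnion.1 he
  by_cases hri : r = Sum.inr i
  · subst hri
    rw [hgi] at hr
    rcases mem_union.1 hr with hr | hr
    · exact ⟨Sum.inl (Fin.last m), hNC.subset_sym2 hr⟩
    · exact ⟨Sum.inr (Sum.inl ()), hND.subset_sym2 hr⟩
  · obtain ⟨r', hr'⟩ := Bfam_subset_fineP i h π hri
    have hgr : IsPMOn (Bfam π r) (g r) := mem_perfectMatchings.1 (Fintype.mem_piFinset.1 hg r)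
    exact ⟨r', Finset.sym2_mono hr' (hgr.subset_sym2 hr)⟩

/-- `|{x ∈ X : x_i = F₀}| ≤ |ℳex(θ' · π)|` for the reference `F₀`. [folklore] -/
theorem card_fiber_le_Mex3 {NC ND : Finset (Sym2 (Slot m q))} (hNC : IsPMOn (Chalf i h π) NC)
    (hND : IsPMOn (Dhalf i h π) ND) :
    ((Xfam π).filter fun g => g (Sum.inr i) = NC ∪ ND).card ≤ (Mex3 (theta i h * π)).card := by
  refine card_le_card_of_injOn (glueH π) (fun g hg => ?_) ((glueH_injOn π).mono ?_)
  · rw [mem_coe, mem_filter] at hg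
    exact mem_coe.2 (glueH_mem_Mex3 i h π hg.1 hNC hND hg.2)
  · exact coe_subset.2 (filter_subset _ _)

/-- The reference `F₀` is a coordinate value: `NC ∪ ND ∈ PM(B̃_i)`. [folklore] -/
theorem ncPM_mem {NC ND : Finset (Sym2 (Slot m q))} (hNC : IsPMOn (Chalf i h π) NC)
    (hND : IsPMOn (Dhalf i h π) ND) : NC ∪ ND ∈ perfectMatchings (Bfam π (Sum.inr i)) := by
  rw [mem_perfectMatchings, ← Chalf_union_Dhalf i h π]
  exact hNC.union hND (disjoint_Chalf_Dhalf i h π)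

end halves

/-! ### Product counting -/

/-- Auxiliary (`card_Xfam_pos`). [folklore] -/
theorem card_Xfam_pos (hqe : Even q) (π : Equiv.Perm (Slot m q)) : 0 < (Xfam π).card := by
  rw [Xfam, Fintype.card_piFinset]
  refine Finset.prod_pos fun r _ => card_pos.2 (perfectMatchings_nonempty ?_)
  rcases r with j | j
  · rw [Bfam_inl, Ablk, card_pull, card_aSlots]; exact hqe
  · rw [card_Bfam_inr π j]; exact even_two_mul q

/-- `|X| = |X_i| · |{x ∈ X : x_i = a}|` for `a ∈ X_i`. [folklore] -/
theorem card_Xfam_eq_mul (π : Equiv.Perm (Slot m q)) (r : Fin m ⊕ Fin (m + 1)) {a : Finset (Sym2 (Slot m q))}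
    (ha : a ∈ perfectMatchings (Bfam π r)) :
    (Xfam π).card = (perfectMatchings (Bfam π r)).card * ((Xfam π).filter fun g => g r = a).card := by
  rw [Xfam, Fintype.card_filter_piFinset_eq_of_mem (fun r => perfectMatchings (Bfam π r)) r ha, Fintype.card_piFinset,
    ← Finset.mul_prod_erase _ _ (mem_univ r)]

/-- A bound on `|PM(B̃_i)|` depending only on `q`. [folklore] -/
def Qbound (q : ℕ) : ℕ := 2 ^ Nat.choose (2 * q + 1) 2

/-- Auxiliary (`card_PM_Bfam_le`). [folklore] -/
theorem card_PM_Bfam_le (π : Equiv.Perm (Slot m q)) (i : Fin (m + 1)) :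
    (perfectMatchings (Bfam π (Sum.inr i))).card ≤ Qbound q := by
  have hsub : perfectMatchings (Bfam π (Sum.inr i)) ⊆ (Bfam π (Sum.inr i)).sym2.powerset := by
    intro M hM
    rw [mem_powerset]
    exact (mem_perfectMatchings.1 hM).1
  refine (card_le_card hsub).trans ?_
  rw [card_powerset, Finset.card_sym2, card_Bfam_inr π i, Qbound]

/-- Auxiliary (`one_le_Qbound`). [folklore] -/
theorem one_le_Qbound (q : ℕ) : 1 ≤ Qbound q := Nat.one_le_two_pow

/-! ### `Y`, `M`-goodness as unbiasedness, and "not small" -/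

section Y

variable (ℳ : Finset (Finset (Sym2 (Slot m q)))) (π : Equiv.Perm (Slot m q))

/-- `Y = {x ∈ X : H ∪ x ∈ ℳ}`. [cite: Rothvoss2017, proof of Lemma 15 (PDF p. 12)] -/
def YfamM : Finset (Fin m ⊕ Fin (m + 1) → Finset (Sym2 (Slot m q))) :=
  (Xfam π).filter fun g => glueH π g ∈ ℳ

/-- Auxiliary (`YfamM_subset`). [folklore] -/
theorem YfamM_subset : YfamM ℳ π ⊆ Xfam π := filter_subset _ _

/-- Auxiliary (`card_MsupH_inter`). [folklore] -/
theorem card_MsupH_inter : ((MsupH π) ∩ ℳ).card = (YfamM ℳ π).card := by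
  rw [← filter_mem_eq_inter, card_MsupH_filter]; rfl

/-- Auxiliary (`card_MsupH`). [folklore] -/
theorem card_MsupH : (MsupH π).card = (Xfam π).card := by
  rw [MsupH_eq_image, card_image_of_injOn (glueH_injOn π)]

variable {ℳ π}

/-- The four counts in `M`-goodness, through the product. [folklore] -/
theorem counts_theta (i : Fin (m + 1)) (h : Equiv.Perm (Bool × Fin q)) {Fi : Finset (Sym2 (Slot m q))}
    (hFi : IsPMOn (Bfam π (Sum.inr i)) Fi) :
    (Msup (theta i h * π) (Hm π) ∩ ℳ).card = (YfamM ℳ π).card ∧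
    (Msup (theta i h * π) (Hm π)).card = (Xfam π).card ∧
    (Msup (theta i h * π) (Hm π ∪ Fi) ∩ ℳ).card = ((YfamM ℳ π).filter fun g => g (Sum.inr i) = Fi).card ∧
    (Msup (theta i h * π) (Hm π ∪ Fi)).card = ((Xfam π).filter fun g => g (Sum.inr i) = Fi).card := by
  refine ⟨by rw [Msup_theta_Hm, card_MsupH_inter], by rw [Msup_theta_Hm, card_MsupH], ?_, ?_⟩
  · rw [Msup_theta_of_Hm_subset i h π subset_union_left, ← filter_mem_eq_inter, filter_filter, card_MsupH_filter,
      YfamM, filter_filter]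
    congr 1
    apply filter_congr
    intro g hg
    rw [union_subset_iff, subset_glueH_iff hg hFi]
    exact ⟨fun ⟨⟨_, h1⟩, h2⟩ => ⟨h2, h1⟩, fun ⟨h2, h1⟩ => ⟨⟨subset_union_left, h1⟩, h2⟩⟩
  · rw [Msup_theta_of_Hm_subset i h π subset_union_left, card_MsupH_filter]
    congr 1
    apply filter_congr
    intro g hg
    rw [union_subset_iff, subset_glueH_iff hg hFi]
    exact ⟨fun ⟨_, h1⟩ => h1, fun h1 => ⟨subset_union_left, h1⟩⟩

/-- **Not `M`-good with `Y ≠ ∅` ⇒ coordinate `i` of `Y` is `ε`-biased.**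
[cite: Rothvoss2017, proof of Lemma 15 (PDF p. 12: "(T,H) is M-good if and only if i ∈ [m+1] is ε-unbiased")] -/
theorem mbad_biased {ε : ℝ} (i : Fin (m + 1)) (h : Equiv.Perm (Bool × Fin q))
    (hYne : (YfamM ℳ π).Nonempty) (hng : ¬MGood ε ℳ (theta i h * π)) :
    ∃ a ∈ perfectMatchings (Bfam π (Sum.inr i)),
      (1 + ε) * ((perfectMatchings (Bfam π (Sum.inr i))).card : ℝ) *
          (((YfamM ℳ π).filter fun g => g (Sum.inr i) = a).card : ℝ) < (YfamM ℳ π).card ∨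
      (1 + ε) * ((YfamM ℳ π).card : ℝ) <
          ((perfectMatchings (Bfam π (Sum.inr i))).card : ℝ) * (((YfamM ℳ π).filter fun g => g (Sum.inr i) = a).card : ℝ) := by
  simp only [MGood, not_forall] at hng
  obtain ⟨F, hFpm, hHF, hbad⟩ := hng
  rw [not_and_or, not_and_or, not_lt, not_le, not_le] at hbad
  rw [Hm_theta_mul] at hHF hbad
  have hFi := (isPMOn_CD_theta_iff i h π hHF).1 hFpm
  set Fi := F \ Hm π with hFi'
  have hFeq : F = Hm π ∪ Fi := (union_sdiff_of_subset hHF).symm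
  rw [hFeq] at hbad
  obtain ⟨c1, c2, c3, c4⟩ := counts_theta (ℳ := ℳ) i h hFi
  rw [c1, c2, c3, c4] at hbad
  have ha : Fi ∈ perfectMatchings (Bfam π (Sum.inr i)) := mem_perfectMatchings.2 hFi
  have hX := card_Xfam_eq_mul π (Sum.inr i) ha
  refine ⟨Fi, ha, ?_⟩
  have hXpos : (0 : ℝ) < ((Xfam π).filter fun g => g (Sum.inr i) = Fi).card := by
    have hXp : 0 < (Xfam π).card := lt_of_lt_of_le hYne.card_pos (card_le_card (YfamM_subset ℳ π))
    rw [hX] at hXp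
    exact_mod_cast pos_of_mul_pos_right hXp (Nat.zero_le _)
  have hXR : ((Xfam π).card : ℝ) = ((perfectMatchings (Bfam π (Sum.inr i))).card : ℝ) *
      (((Xfam π).filter fun g => g (Sum.inr i) = Fi).card : ℝ) := by exact_mod_cast hX
  rcases hbad with hY0 | h2 | h3
  · exfalso
    have : (0 : ℝ) < (YfamM ℳ π).card := by exact_mod_cast hYne.card_pos
    linarith
  · -- `|Y| · DF > (1+ε) NF · |X|`
    left
    rw [hXR] at h2
    nlinarith
  · right
    rw [hXR] at h3
    nlinarith

/-- **Not small ⇒ `|Y| > θ |X| / Q`.** [cite: Rothvoss2017, proof of Lemma 15 (PDF p. 12)] -/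
theorem card_Y_gt_of_not_small {μ : ℕ} {θ : ℝ} (hθ : 0 ≤ θ) {𝒰 : Finset (Finset (Slot m q))} (hqe : Even q)
    (i : Fin (m + 1)) (h : Equiv.Perm (Bool × Fin q)) (hns : ¬Small μ θ 𝒰 ℳ (theta i h * π)) :
    θ * ((Xfam π).card : ℝ) / Qbound q < (YfamM ℳ π).card := by
  simp only [Small, not_or, not_le] at hns
  obtain ⟨hM, -⟩ := hns
  obtain ⟨NC, ND, hNC, hND⟩ := exists_ncPM i h π hqe
  have hfib := card_fiber_le_Mex3 i h π hNC hND
  have ha := ncPM_mem i h π hNC hND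
  have hX := card_Xfam_eq_mul π (Sum.inr i) ha
  have hQ := card_PM_Bfam_le π i
  -- `|ℳex ∩ ℳ| ≤ |MsupH ∩ ℳ| = |Y|`
  have hsub : Mex3 (theta i h * π) ∩ ℳ ⊆ MsupH π ∩ ℳ := inter_subset_inter_right (Mex3_theta_subset i h π)
  have h1 : ((Mex3 (theta i h * π) ∩ ℳ).card : ℝ) ≤ (YfamM ℳ π).card := by
    rw [← card_MsupH_inter]; exact_mod_cast card_le_card hsub
  -- `θ |X| / Q ≤ θ |fibre| ≤ θ |ℳex| < |ℳex ∩ ℳ|`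
  have hQpos : (0 : ℝ) < Qbound q := by exact_mod_cast one_le_Qbound q
  have h2 : ((Xfam π).card : ℝ) / Qbound q ≤ ((Xfam π).filter fun g => g (Sum.inr i) = NC ∪ ND).card := by
    rw [div_le_iff₀ hQpos]
    have hX' : ((Xfam π).card : ℝ) = ((perfectMatchings (Bfam π (Sum.inr i))).card : ℝ) *
        (((Xfam π).filter fun g => g (Sum.inr i) = NC ∪ ND).card : ℝ) := by exact_mod_cast hX
    rw [hX', mul_comm]
    exact mul_le_mul_of_nonneg_left (by exact_mod_cast hQ) (Nat.cast_nonneg _)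
  have h3 : (((Xfam π).filter fun g => g (Sum.inr i) = NC ∪ ND).card : ℝ) ≤ (Mex3 (theta i h * π)).card := by
    exact_mod_cast hfib
  calc θ * ((Xfam π).card : ℝ) / Qbound q = θ * (((Xfam π).card : ℝ) / Qbound q) := by ring
    _ ≤ θ * (Mex3 (theta i h * π)).card := mul_le_mul_of_nonneg_left (h2.trans h3) hθ
    _ < ((Mex3 (theta i h * π) ∩ ℳ).card : ℝ) := hM
    _ ≤ (YfamM ℳ π).card := h1

end Y

/-! ### A compatible exchange exists for every block -/

section compat

variable {μ : ℕ} {Ustar : Finset (Slot m q)} {Mstar : Finset (Sym2 (Slot m q))}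

/-- `2 |N| = |S|` for a perfect matching. [folklore] -/
theorem IsPMOn.two_mul_card_slot {S : Finset (Slot m q)} {N : Finset (Sym2 (Slot m q))} (hN : IsPMOn S N) :
    2 * N.card = S.card := by
  rw [hN.card_eq_sum_cutCount subset_rfl, Finset.card_eq_sum_ones, mul_sum]
  refine sum_congr rfl fun e he => ?_
  induction e using Sym2.ind with
  | h u v => simp [cutCount_mk, hN.mem_of_mem he (Sym2.mem_mk_left u v), hN.mem_of_mem he (Sym2.mem_mk_right u v)]

/-- A relabelling of `Bool × Fin q` whose first coordinate is a prescribed predicate with `q`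
true values. [folklore] -/
theorem exists_perm_fst_eq (T : Finset (Bool × Fin q)) (hT : T.card = q) :
    ∃ h : Equiv.Perm (Bool × Fin q), ∀ p, (h p).1 = decide (p ∈ T) := by
  have hc1 : Fintype.card {p : Bool × Fin q // p ∈ T} = Fintype.card {p : Bool × Fin q // p.1 = true} := by
    rw [Fintype.card_coe, hT, Fintype.card_subtype]
    have : (univ.filter fun p : Bool × Fin q => p.1 = true) = (univ : Finset (Fin q)).image fun x => (true, x) := by
      ext ⟨b, x⟩; simp
    rw [this, card_image_of_injective _ (fun x y h => by simpa using h)]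
    simp
  have hc2 : Fintype.card {p : Bool × Fin q // p ∉ T} = Fintype.card {p : Bool × Fin q // ¬p.1 = true} := by
    rw [Fintype.card_subtype_compl, Fintype.card_subtype_compl, hc1]
  refine ⟨(Equiv.sumCompl fun p => p ∈ T).symm.trans
    ((Equiv.sumCongr (Fintype.equivOfCardEq hc1) (Fintype.equivOfCardEq hc2)).trans
      (Equiv.sumCompl fun p : Bool × Fin q => p.1 = true)), fun p => ?_⟩
  by_cases hp : p ∈ T
  · rw [Equiv.trans_apply, Equiv.trans_apply,
      show (Equiv.sumCompl fun p => p ∈ T).symm p = Sum.inl ⟨p, hp⟩ from (Equiv.symm_apply_eq _).2 (by simp)]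
    simp only [Equiv.sumCongr_apply, Sum.map_inl, Equiv.sumCompl_apply_inl, hp, decide_true]
    exact (Fintype.equivOfCardEq hc1 ⟨p, hp⟩).2
  · rw [Equiv.trans_apply, Equiv.trans_apply,
      show (Equiv.sumCompl fun p => p ∈ T).symm p = Sum.inr ⟨p, hp⟩ from (Equiv.symm_apply_eq _).2 (by simp)]
    simp only [Equiv.sumCongr_apply, Sum.map_inr, Equiv.sumCompl_apply_inr, hp, decide_false]
    have := (Fintype.equivOfCardEq hc2 ⟨p, hp⟩).2
    simpa using this

/-- **For `M* ∈ MsupH π` and every block `B_{i₀}`, some split `h` makes `M*` non-crossing**, i.e.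
`M* ∈ ℳex(bswap i₀ h · π)`. [cite: Rothvoss2017, proof of Lemma 15 (PDF p. 12)] -/
theorem exists_compat_bswap (hqe : Even q) {π : Equiv.Perm (Slot m q)} (hM : Mstar ∈ MsupH π) (i₀ : Fin m) :
    ∃ h : Equiv.Perm (Bool × Fin q), Mstar ∈ Mex3 (bswap i₀ h * π) := by
  have hM' := hM
  rw [MsupH, mem_filter] at hM'
  obtain ⟨-, hHM, hN, hresp⟩ := hM'
  rw [← biUnion_Bfam] at hN
  -- the block of `M* \ H` on `B_{i₀}`
  set N := (Mstar \ Hm π).filter fun e => e ∈ (Bblk π i₀).sym2 with hNdef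
  have hNpm : IsPMOn (Bblk π i₀) N := by
    have := hN.filter_block (Bfam π) (Bfam_disjoint π) univ
      (fun e he => by obtain ⟨r, hr⟩ := hresp e he; exact ⟨r, mem_univ _, hr⟩) (mem_univ (Sum.inr (Fin.castSucc i₀)))
    rwa [Bfam_inr_castSucc] at this
  have hNcard : N.card = q := by
    have := hNpm.two_mul_card_slot
    rw [Bblk, card_pull, card_bSlots] at this
    omega
  -- half of its edges
  obtain ⟨E₁, hE₁N, hE₁card⟩ : ∃ E₁ ⊆ N, E₁.card = q / 2 := exists_subset_card_eq (by rw [hNcard]; omega)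
  -- the vertices of `E₁`, as slots of `B_{i₀}`
  set side : Slot m q → Bool := fun v => decide (∃ e ∈ E₁, v ∈ e) with hside
  set T : Finset (Bool × Fin q) := univ.filter fun p => side (π.symm (b i₀ p.1 p.2)) = true with hT
  have hE₁pm : IsPMOn (univ.filter fun v => side v = true) E₁ := by
    refine ⟨fun e he => ?_, fun e he => hNpm.not_isDiag (hE₁N he), fun v hv => ?_⟩
    · induction e using Sym2.ind with
      | h u v =>
        rw [mk_mem_sym2_iff, mem_filter, mem_filter]
        simp only [mem_univ, true_and, hside, decide_eq_true_eq]
        exact ⟨⟨_, he, Sym2.mem_mk_left u v⟩, ⟨_, he, Sym2.mem_mk_right u v⟩⟩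
    · simp only [mem_filter, mem_univ, true_and, hside, decide_eq_true_eq] at hv
      obtain ⟨e, he, hve⟩ := hv
      rw [card_eq_one]
      refine ⟨e, ?_⟩
      ext f
      simp only [mem_filter, mem_singleton]
      constructor
      · rintro ⟨hf, hvf⟩
        exact hNpm.unique (hE₁N hf) (hE₁N he) hvf hve
      · rintro rfl; exact ⟨he, hve⟩
  have hV : (univ.filter fun v : Slot m q => side v = true).card = q := by
    have h2 := hE₁pm.two_mul_card_slot
    rw [hE₁card] at h2
    obtain ⟨r, hr⟩ := hqe; omega
  have hTV : T.card = (univ.filter fun v : Slot m q => side v = true).card := by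
    apply card_nbij (fun p : Bool × Fin q => π.symm (b i₀ p.1 p.2))
    · intro p hp
      rw [mem_coe, hT, mem_filter] at hp
      exact mem_coe.2 (mem_filter.2 ⟨mem_univ _, hp.2⟩)
    · intro p _ p' _ hpp'
      have := π.symm.injective hpp'
      simp only [Slot.b.injEq, true_and] at this
      exact Prod.ext this.1 this.2
    · intro v hv
      rw [mem_coe, mem_filter] at hv
      have hv' : ∃ e ∈ E₁, v ∈ e := by simpa [hside] using hv.2
      obtain ⟨e, he, hve⟩ := hv'
      have hvB : v ∈ Bblk π i₀ := by
        induction e using Sym2.ind with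
        | h x y =>
          have := hNpm.subset_sym2 (hE₁N he)
          rw [mk_mem_sym2_iff] at this
          rcases Sym2.mem_iff.1 hve with rfl | rfl
          exacts [this.1, this.2]
      obtain ⟨sd, x, hx⟩ := mem_Bblk.1 hvB
      have hpv : π.symm (b i₀ sd x) = v := by rw [← hx]; simp
      refine ⟨(sd, x), ?_, hpv⟩
      rw [mem_coe, hT, mem_filter]
      refine ⟨mem_univ _, ?_⟩
      show side (π.symm (b i₀ sd x)) = true
      rw [hpv]
      simpa [hside] using ⟨e, he, hve⟩
  have hTcard : T.card = q := hTV.trans hV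
  obtain ⟨h, hh⟩ := exists_perm_fst_eq T hTcard
  refine ⟨h, ?_⟩
  -- the halves are `V(E₁) ∩ B_{i₀}` and its complement in `B_{i₀}`
  have hhalfD : ∀ v, v ∈ halfD i₀ h π ↔ v ∈ Bblk π i₀ ∧ side v = true := by
    intro v
    simp only [halfD, mem_filter, mem_univ, true_and, mem_Bblk, hh, hT, decide_eq_true_eq]
    constructor
    · rintro ⟨sd, x, hv, hs⟩
      refine ⟨⟨sd, x, hv⟩, ?_⟩
      rwa [show π.symm (b i₀ sd x) = v from by rw [← hv]; simp] at hs
    · rintro ⟨⟨sd, x, hv⟩, hs⟩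
      refine ⟨sd, x, hv, ?_⟩
      rwa [show π.symm (b i₀ sd x) = v from by rw [← hv]; simp]
  have hhalfC : ∀ v, v ∈ halfC i₀ h π ↔ v ∈ Bblk π i₀ ∧ side v = false := by
    intro v
    simp only [halfC, mem_filter, mem_univ, true_and, mem_Bblk, hh, hT, decide_eq_false_iff_not]
    constructor
    · rintro ⟨sd, x, hv, hs⟩
      refine ⟨⟨sd, x, hv⟩, ?_⟩
      rw [show π.symm (b i₀ sd x) = v from by rw [← hv]; simp] at hs
      simpa using hs
    · rintro ⟨⟨sd, x, hv⟩, hs⟩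
      refine ⟨sd, x, hv, ?_⟩
      rw [show π.symm (b i₀ sd x) = v from by rw [← hv]; simp]
      simpa using hs
  rw [mem_Mex3_iff, Hm_bswap_mul, biUnion_fineP, cset_bswap_mul, dset_bswap_mul, ← biUnion_Bfam]
  refine ⟨hHM, hN, fun e he => ?_⟩
  obtain ⟨r, hr⟩ := hresp e he
  by_cases hri : r = Sum.inr (Fin.castSucc i₀)
  · subst hri
    rw [Bfam_inr_castSucc] at hr
    have heN : e ∈ N := mem_filter.2 ⟨he, hr⟩
    induction e using Sym2.ind with
    | h u v =>
      rw [mk_mem_sym2_iff] at hr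
      by_cases he1 : s(u, v) ∈ E₁
      · -- both endpoints on the `D`-side
        refine ⟨Sum.inr (Sum.inl ()), ?_⟩
        show s(u, v) ∈ (Drest (bswap i₀ h * π)).sym2
        rw [Drest_bswap_mul, mk_mem_sym2_iff, hhalfD, hhalfD]
        simp only [hside, decide_eq_true_eq]
        exact ⟨⟨hr.1, _, he1, Sym2.mem_mk_left u v⟩, ⟨hr.2, _, he1, Sym2.mem_mk_right u v⟩⟩
      · -- both endpoints on the `C`-side: an `E₁`-edge at `u` or `v` would be this edge
        refine ⟨Sum.inl (Fin.last m), ?_⟩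
        show s(u, v) ∈ (Atil (bswap i₀ h * π) (Fin.last m)).sym2
        rw [Crest_bswap_mul, mk_mem_sym2_iff, hhalfC, hhalfC]
        simp only [hside, decide_eq_false_iff_not, not_exists, not_and]
        exact ⟨⟨hr.1, fun f hf huf => he1 (hNpm.unique heN (hE₁N hf) (Sym2.mem_mk_left u v) huf ▸ hf)⟩,
          ⟨hr.2, fun f hf hvf => he1 (hNpm.unique heN (hE₁N hf) (Sym2.mem_mk_right u v) hvf ▸ hf)⟩⟩
  · obtain ⟨r', hr'⟩ := Bfam_subset_fineP (Fin.castSucc i₀) h π hri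
    rw [theta_castSucc] at hr'
    exact ⟨r', Finset.sym2_mono hr' hr⟩

/-- Compatibility after an exchange, unfolded. [folklore] -/
theorem compat_theta_iff (hq : 0 < q) (i : Fin (m + 1)) (h : Equiv.Perm (Bool × Fin q)) (π : Equiv.Perm (Slot m q)) :
    Compat μ Ustar Mstar (theta i h * π) ↔ Ustar ∈ Uex3 μ π ∧ Mstar ∈ Mex3 (theta i h * π) := by
  rw [Compat]
  induction i using Fin.lastCases with
  | last => rw [theta_last, one_mul]
  | cast i₀ => rw [theta_castSucc, Uex3_bswap_mul _ _ _ _ hq]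

/-- **At least `m` members of the family `(i, h)` are compatible** when one is. [folklore] -/
theorem card_compat_family_ge (hq : 0 < q) (hqe : Even q) (π : Equiv.Perm (Slot m q))
    (hU : Ustar ∈ Uex3 μ π) (hM : Mstar ∈ MsupH π) :
    m ≤ ((univ : Finset (Fin (m + 1) × Equiv.Perm (Bool × Fin q))).filter
      fun ih => Compat μ Ustar Mstar (theta ih.1 ih.2 * π)).card := by
  choose hsel hhsel using fun i₀ : Fin m => exists_compat_bswap hqe hM i₀
  have hinj : Function.Injective fun i₀ : Fin m => (Fin.castSucc i₀, hsel i₀) :=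
    fun a b hab => Fin.castSucc_injective _ (congrArg Prod.fst hab)
  calc m = (univ : Finset (Fin m)).card := by simp
    _ = ((univ : Finset (Fin m)).image fun i₀ => (Fin.castSucc i₀, hsel i₀)).card :=
        (card_image_of_injective _ hinj).symm
    _ ≤ _ := card_le_card fun ih hih => by
        obtain ⟨i₀, -, rfl⟩ := mem_image.1 hih
        rw [mem_filter, compat_theta_iff hq]
        exact ⟨mem_univ _, hU, by rw [theta_castSucc]; exact hhsel i₀⟩

end compat

/-! ### Lemma 15 -/

section lemma15

variable (μ : ℕ) (ε θ : ℝ) (𝒰 : Finset (Finset (Slot m q))) (ℳ : Finset (Finset (Sym2 (Slot m q))))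
  (Ustar : Finset (Slot m q)) (Mstar : Finset (Sym2 (Slot m q)))

/-- `M`-bad: neither small nor `M`-good. [cite: Rothvoss2017, §3.6 (PDF p. 11)] -/
def MBad (π : Equiv.Perm (Slot m q)) : Prop := ¬Small μ θ 𝒰 ℳ π ∧ ¬MGood ε ℳ π

/-- The constant of the entropy lemma for `ε`-bias with at most `Qbound q` values. [folklore] -/
def cM (q : ℕ) (ε : ℝ) : ℝ := (ε / ((1 + ε) * ((Qbound q : ℕ) : ℝ))) ^ 2 / 2

variable {μ ε θ 𝒰 ℳ Ustar Mstar}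

/-- Auxiliary (`card_PM_Bfam_le'`). [folklore] -/
theorem card_PM_Bfam_le' (π : Equiv.Perm (Slot m q)) (r : Fin m ⊕ Fin (m + 1)) :
    (perfectMatchings (Bfam π r)).card ≤ Qbound q := by
  rcases r with j | i
  · have hsub : perfectMatchings (Bfam π (Sum.inl j)) ⊆ (Bfam π (Sum.inl j)).sym2.powerset := by
      intro M hM; rw [mem_powerset]; exact (mem_perfectMatchings.1 hM).1
    refine (card_le_card hsub).trans ?_
    rw [card_powerset, Finset.card_sym2, Bfam_inl, Ablk, card_pull, card_aSlots, Qbound]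
    apply Nat.pow_le_pow_right (by norm_num)
    exact Nat.choose_le_choose 2 (by omega)
  · exact card_PM_Bfam_le π i

/-- **For fixed `h`, few indices `i` are compatible and `M`-bad** (entropy count).
[cite: Rothvoss2017, proof of Lemma 15 (PDF p. 12)] -/
theorem mbad_count_le (hqe : Even q) (hε : 0 < ε) (hθ : 0 < θ) (hθ1 : θ ≤ 1) (π : Equiv.Perm (Slot m q))
    (h : Equiv.Perm (Bool × Fin q)) :
    (((univ : Finset (Fin (m + 1))).filter fun i =>
        Compat μ Ustar Mstar (theta i h * π) ∧ MBad μ ε θ 𝒰 ℳ (theta i h * π)).card : ℝ) ≤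
      (Real.log (Qbound q : ℝ) - Real.log θ) / cM q ε := by
  set B := (univ : Finset (Fin (m + 1))).filter fun i =>
      Compat μ Ustar Mstar (theta i h * π) ∧ MBad μ ε θ 𝒰 ℳ (theta i h * π) with hB
  have hQ1 : (1 : ℝ) ≤ Qbound q := by exact_mod_cast one_le_Qbound q
  have hQpos : (0 : ℝ) < Qbound q := by linarith
  have hcMpos : 0 < cM q ε := by rw [cM]; positivity
  have hnum : 0 ≤ Real.log (Qbound q : ℝ) - Real.log θ := by
    have h1 := Real.log_nonneg hQ1
    have h2 := Real.log_nonpos hθ.le hθ1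
    linarith
  rcases B.eq_empty_or_nonempty with hB0 | ⟨i₁, hi₁⟩
  · rw [hB0, card_empty, Nat.cast_zero]
    exact div_nonneg hnum hcMpos.le
  have hi₁' := (mem_filter.1 hi₁).2
  have hYgt := card_Y_gt_of_not_small (ℳ := ℳ) (π := π) hθ.le hqe i₁ h hi₁'.2.1
  have hXpos : (0 : ℝ) < (Xfam π).card := by exact_mod_cast card_Xfam_pos hqe π
  have hYpos : (0 : ℝ) < (YfamM ℳ π).card := lt_of_le_of_lt (by positivity) hYgt
  have hYne : (YfamM ℳ π).Nonempty := by
    rw [← card_pos]; exact_mod_cast hYpos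
  -- the entropy lemma, biased coordinates `inr i`, `i ∈ B`
  have hent := card_biased_mul_le_log (fun r => perfectMatchings (Bfam π r)) (YfamM ℳ π) (YfamM_subset ℳ π)
    hYne hε (q := Qbound q) (card_PM_Bfam_le' π) (B.map ⟨Sum.inr, Sum.inr_injective⟩) (fun r hr => by
      obtain ⟨i, hi, rfl⟩ := mem_map.1 hr
      have hi' := (mem_filter.1 hi).2
      exact mbad_biased i h hYne hi'.2.2)
  rw [card_map] at hent
  have hprod : (∏ r, ((perfectMatchings (Bfam π r)).card : ℝ)) = (Xfam π).card := by
    rw [Xfam, Fintype.card_piFinset, Nat.cast_prod]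
  rw [hprod] at hent
  change (B.card : ℝ) * cM q ε ≤ _ at hent
  have hlogY : Real.log θ + Real.log ((Xfam π).card : ℝ) - Real.log (Qbound q : ℝ) < Real.log ((YfamM ℳ π).card : ℝ) := by
    have hpos : 0 < θ * ((Xfam π).card : ℝ) / Qbound q := by positivity
    have := Real.log_lt_log hpos hYgt
    rw [Real.log_div (by positivity) hQpos.ne', Real.log_mul hθ.ne' hXpos.ne'] at this
    linarith
  have : (B.card : ℝ) * cM q ε ≤ Real.log (Qbound q : ℝ) - Real.log θ := by linarith
  rwa [le_div_iff₀ hcMpos]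

/-- **Lemma 15, pointwise form**: for every `π`, among the family `(i, h)`, the compatible
`M`-bad members are at most a quarter of the compatible ones — given the largeness hypothesis
`hβ : (2q)! · (Real.log Q - Real.log θ)/c ≤ m/4`. [cite: Rothvoss2017, Lemma 15 (PDF p. 12)] -/
theorem mbad_pointwise (hq : 0 < q) (hqe : Even q) (hε : 0 < ε) (hθ : 0 < θ) (hθ1 : θ ≤ 1)
    (hβ : ((2 * q).factorial : ℝ) * ((Real.log (Qbound q : ℝ) - Real.log θ) / cM q ε) ≤ (m : ℝ) / 4)
    (π : Equiv.Perm (Slot m q)) :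
    (((univ : Finset (Fin (m + 1) × Equiv.Perm (Bool × Fin q))).filter fun ih =>
        Compat μ Ustar Mstar (theta ih.1 ih.2 * π) ∧ MBad μ ε θ 𝒰 ℳ (theta ih.1 ih.2 * π)).card : ℝ) ≤
      (1 / 4) * (((univ : Finset (Fin (m + 1) × Equiv.Perm (Bool × Fin q))).filter fun ih =>
        Compat μ Ustar Mstar (theta ih.1 ih.2 * π)).card : ℝ) := by
  -- LHS as a sum over `h` of the per-`h` counts
  have hLHS : (((univ : Finset (Fin (m + 1) × Equiv.Perm (Bool × Fin q))).filter fun ih =>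
        Compat μ Ustar Mstar (theta ih.1 ih.2 * π) ∧ MBad μ ε θ 𝒰 ℳ (theta ih.1 ih.2 * π)).card : ℝ) =
      ∑ h : Equiv.Perm (Bool × Fin q), (((univ : Finset (Fin (m + 1))).filter fun i =>
        Compat μ Ustar Mstar (theta i h * π) ∧ MBad μ ε θ 𝒰 ℳ (theta i h * π)).card : ℝ) := by
    rw [card_filter, Nat.cast_sum, Fintype.sum_prod_type_right]
    refine sum_congr rfl fun h _ => ?_
    rw [card_filter, Nat.cast_sum]
  have hper := fun h => mbad_count_le (μ := μ) (ε := ε) (θ := θ) (𝒰 := 𝒰) (ℳ := ℳ) (Ustar := Ustar)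
    (Mstar := Mstar) hqe hε hθ hθ1 π h
  have hL : (((univ : Finset (Fin (m + 1) × Equiv.Perm (Bool × Fin q))).filter fun ih =>
        Compat μ Ustar Mstar (theta ih.1 ih.2 * π) ∧ MBad μ ε θ 𝒰 ℳ (theta ih.1 ih.2 * π)).card : ℝ) ≤
      ((2 * q).factorial : ℝ) * ((Real.log (Qbound q : ℝ) - Real.log θ) / cM q ε) := by
    rw [hLHS]
    calc ∑ h : Equiv.Perm (Bool × Fin q), (((univ : Finset (Fin (m + 1))).filter fun i =>
          Compat μ Ustar Mstar (theta i h * π) ∧ MBad μ ε θ 𝒰 ℳ (theta i h * π)).card : ℝ)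
        ≤ ∑ _h : Equiv.Perm (Bool × Fin q), (Real.log (Qbound q : ℝ) - Real.log θ) / cM q ε := sum_le_sum fun h _ => hper h
      _ = ((2 * q).factorial : ℝ) * ((Real.log (Qbound q : ℝ) - Real.log θ) / cM q ε) := by
          rw [sum_const, nsmul_eq_mul, card_univ, Fintype.card_perm, Fintype.card_prod, Fintype.card_bool,
            Fintype.card_fin]
  by_cases hbase : Ustar ∈ Uex3 μ π ∧ Mstar ∈ MsupH π
  · have hR := card_compat_family_ge (μ := μ) hq hqe π hbase.1 hbase.2
    have hR' : (m : ℝ) ≤ (((univ : Finset (Fin (m + 1) × Equiv.Perm (Bool × Fin q))).filter fun ih =>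
        Compat μ Ustar Mstar (theta ih.1 ih.2 * π)).card : ℝ) := by exact_mod_cast hR
    linarith
  · have h0 : ((univ : Finset (Fin (m + 1) × Equiv.Perm (Bool × Fin q))).filter fun ih =>
        Compat μ Ustar Mstar (theta ih.1 ih.2 * π) ∧ MBad μ ε θ 𝒰 ℳ (theta ih.1 ih.2 * π)) = ∅ := by
      rw [filter_eq_empty_iff]
      rintro ⟨i, h⟩ - ⟨hc, -⟩
      rw [compat_theta_iff hq] at hc
      exact hbase ⟨hc.1, Mex3_theta_subset i h π hc.2⟩
    rw [h0, card_empty, Nat.cast_zero]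
    positivity

/-- **Lemma 15.** At most a quarter of the partitions compatible with `(U*, M*)` are `M`-bad.
[cite: Rothvoss2017, Lemma 15 (PDF p. 12)] -/
theorem card_compat_mbad_le (hq : 0 < q) (hqe : Even q) (hε : 0 < ε) (hθ : 0 < θ) (hθ1 : θ ≤ 1)
    (hβ : ((2 * q).factorial : ℝ) * ((Real.log (Qbound q : ℝ) - Real.log θ) / cM q ε) ≤ (m : ℝ) / 4) :
    ((univ.filter fun π : Equiv.Perm (Slot m q) =>
        Compat μ Ustar Mstar π ∧ MBad μ ε θ 𝒰 ℳ π).card : ℝ) ≤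
      (1 / 4) * ((univ.filter fun π : Equiv.Perm (Slot m q) => Compat μ Ustar Mstar π).card : ℝ) := by
  haveI : Nonempty (Fin (m + 1) × Equiv.Perm (Bool × Fin q)) := ⟨(0, 1)⟩
  exact card_filter_and_le_of_fibres
    (fun ih : Fin (m + 1) × Equiv.Perm (Bool × Fin q) => Equiv.mulLeft (theta (q := q) ih.1 ih.2))
    (Compat μ Ustar Mstar) (MBad μ ε θ 𝒰 ℳ) (1 / 4) fun π => mbad_pointwise hq hqe hε hθ hθ1 hβ π

end lemma15

end Literature.Barriers.PneNP

end


/-! ## Part: `TSPExtensionComplexityRothvossLemma7` -/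

/-!
# Rothvoß's Lemma 7 (`μ₃` small unless `μ_k` large) and Lemma 6 (the weight matrix)

Support file for the discharge of `Literature.Barriers.PneNP.Rothvoss2017_tsp` (Rothvoß 2017,
§3.2–3.3 and §2). Assembly of the sibling files, in the slot model with explicit constants:

* **Lemma 7** (`sum_pp_le`): for a rectangle with `μ₁(ℛ) = 0`,
  `μ₃(ℛ) ≤ 2 (1+ε)³ ρ μ_k(ℛ) + 2θ` with `ρ = 3k / C(k,3)`, `θ = 2^{-δm}` — from the generic
  strategy (7) (PDF p. 9): good pairs (`sum_good_le`, Lemma 9), small pairs (`sum_small_le`),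
  bad pairs (`sum_bad_le` with Lemmas 14–15: `card_compat_bad_le`);
* **Lemma 6** (`rect_le`): `⟨W, ℛ⟩ ≤ 2θ` for every rectangle, once `2(1+ε)³ρ ≤ 1/(k-1)`
  ("if `μ₁(ℛ) ≠ 0` then `⟨W,ℛ⟩ = -∞`" is replaced by the finite penalty `-1`, PDF p. 6);
* `exists_W_slot`: the weight datum on `Slot m q` — rectangle sums `≤ 2θ` and `⟨W,S⟩ = 1`
  (`sum_Wmat_slack`) — ready for transport to `Fin n` and Lemma 5.

Sources: [Rothvoss2017] Lemma 6 (PDF p. 6), Lemma 7 and eq. (7) (PDF p. 9), §3.6 (PDF p. 11).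
-/

noncomputable section

open scoped Classical

namespace Literature.Barriers.PneNP

open Finset Slot

variable {m q : ℕ}

section

variable (μ : ℕ) (ε θ : ℝ) (𝒰 : Finset (Finset (Slot m q))) (ℳ : Finset (Finset (Sym2 (Slot m q))))

/-- Auxiliary (`pU3_nonneg`). [folklore] -/
theorem pU3_nonneg (π : Equiv.Perm (Slot m q)) : 0 ≤ pU3 μ 𝒰 π := div_nonneg (Nat.cast_nonneg _) (Nat.cast_nonneg _)
/-- Auxiliary (`pM3_nonneg`). [folklore] -/
theorem pM3_nonneg (π : Equiv.Perm (Slot m q)) : 0 ≤ pM3 ℳ π := div_nonneg (Nat.cast_nonneg _) (Nat.cast_nonneg _)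
/-- Auxiliary (`pUC_nonneg`). [folklore] -/
theorem pUC_nonneg (π : Equiv.Perm (Slot m q)) : 0 ≤ pUC μ 𝒰 π := div_nonneg (Nat.cast_nonneg _) (Nat.cast_nonneg _)
/-- Auxiliary (`pMF_nonneg`). [folklore] -/
theorem pMF_nonneg (π : Equiv.Perm (Slot m q)) : 0 ≤ pMF ℳ π := div_nonneg (Nat.cast_nonneg _) (Nat.cast_nonneg _)

/-- Auxiliary (`pU3_le_one`). [folklore] -/
theorem pU3_le_one (π : Equiv.Perm (Slot m q)) : pU3 μ 𝒰 π ≤ 1 :=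
  div_le_one_of_le₀ (by exact_mod_cast card_le_card inter_subset_left) (Nat.cast_nonneg _)

/-- Auxiliary (`pM3_le_one`). [folklore] -/
theorem pM3_le_one (π : Equiv.Perm (Slot m q)) : pM3 ℳ π ≤ 1 :=
  div_le_one_of_le₀ (by exact_mod_cast card_le_card inter_subset_left) (Nat.cast_nonneg _)

/-- **Small pairs contribute at most `θ`** ("`E[SMALL · p^ex_U p^ex_M] ≤ 2^{-δm}`").
[cite: Rothvoss2017, eq. (7) (PDF p. 9)] -/
theorem sum_small_le (hq : 0 < q) (hqe : Even q) (hm : m = 2 * μ + 1) (hθ : 0 ≤ θ) :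
    ∑ π : Equiv.Perm (Slot m q), (if Small μ θ 𝒰 ℳ π then pU3 μ 𝒰 π * pM3 ℳ π else 0) ≤
      θ * Fintype.card (Equiv.Perm (Slot m q)) := by
  have hpt : ∀ π : Equiv.Perm (Slot m q), (if Small μ θ 𝒰 ℳ π then pU3 μ 𝒰 π * pM3 ℳ π else 0) ≤ θ := by
    intro π
    split_ifs with hs
    · rcases hs with hs | hs
      · have hD : (0 : ℝ) < (Mex3 π).card := by exact_mod_cast (Mex3_nonempty hqe π).card_pos
        have hM : pM3 ℳ π ≤ θ := by rw [pM3, div_le_iff₀ hD]; exact hs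
        calc pU3 μ 𝒰 π * pM3 ℳ π ≤ 1 * θ := mul_le_mul (pU3_le_one μ 𝒰 π) hM (pM3_nonneg ℳ π) zero_le_one
          _ = θ := one_mul θ
      · have hD : (0 : ℝ) < (Uex3 μ π).card := by exact_mod_cast (Uex3_nonempty hq hm π).card_pos
        have hU : pU3 μ 𝒰 π ≤ θ := by rw [pU3, div_le_iff₀ hD]; exact hs
        calc pU3 μ 𝒰 π * pM3 ℳ π ≤ θ * 1 := mul_le_mul hU (pM3_le_one ℳ π) (pM3_nonneg ℳ π) hθ
          _ = θ := mul_one θ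
    · exact hθ
  calc ∑ π : Equiv.Perm (Slot m q), (if Small μ θ 𝒰 ℳ π then pU3 μ 𝒰 π * pM3 ℳ π else 0)
      ≤ ∑ _π : Equiv.Perm (Slot m q), θ := sum_le_sum fun π _ => hpt π
    _ = θ * Fintype.card (Equiv.Perm (Slot m q)) := by rw [sum_const, card_univ, nsmul_eq_mul, mul_comm]

/-- **Lemma 13**: for each `(U, M)`, at most half of the compatible partitions are bad
(Lemma 14: a quarter `U`-bad; Lemma 15: a quarter `M`-bad). [cite: Rothvoss2017, Lemma 13 (PDF p. 11)] -/
theorem card_compat_bad_le (hq : 0 < q) (hqe : Even q) (hm : m = 2 * μ + 1) (hε : 0 < ε)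
    (hθ : 0 < θ) (hθ1 : θ ≤ 1)
    (hβU : (Real.log 2 + Real.log ((m : ℝ) + 1) - Real.log θ) / cU ε ≤ ((μ : ℝ) + 1) / 4)
    (hβM : ((2 * q).factorial : ℝ) * ((Real.log (Qbound q : ℝ) - Real.log θ) / cM q ε) ≤ (m : ℝ) / 4)
    (U : Finset (Slot m q)) (M : Finset (Sym2 (Slot m q))) :
    ((univ.filter fun π : Equiv.Perm (Slot m q) =>
        (U ∈ Uex3 μ π ∧ M ∈ Mex3 π) ∧ Bad μ ε θ 𝒰 ℳ π).card : ℝ) ≤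
      (1 / 2) * ((univ.filter fun π : Equiv.Perm (Slot m q) => U ∈ Uex3 μ π ∧ M ∈ Mex3 π).card : ℝ) := by
  have hU := card_compat_ubad_le (μ := μ) (ε := ε) (θ := θ) (𝒰 := 𝒰) (ℳ := ℳ) (Ustar := U) (Mstar := M)
    hq hm hε hθ hβU
  have hM := card_compat_mbad_le (μ := μ) (ε := ε) (θ := θ) (𝒰 := 𝒰) (ℳ := ℳ) (Ustar := U) (Mstar := M)
    hq hqe hε hθ hθ1 hβM
  have hsub : (univ.filter fun π : Equiv.Perm (Slot m q) => (U ∈ Uex3 μ π ∧ M ∈ Mex3 π) ∧ Bad μ ε θ 𝒰 ℳ π) ⊆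
      (univ.filter fun π : Equiv.Perm (Slot m q) => Compat μ U M π ∧ UBad μ ε θ 𝒰 ℳ π) ∪
        (univ.filter fun π : Equiv.Perm (Slot m q) => Compat μ U M π ∧ MBad μ ε θ 𝒰 ℳ π) := by
    intro π hπ
    rw [mem_filter] at hπ
    obtain ⟨-, hc, hng, hns⟩ := hπ
    rw [mem_union, mem_filter, mem_filter]
    simp only [Good, not_and_or] at hng
    rcases hng with h | h
    · exact Or.inl ⟨mem_univ _, hc, hns, h⟩
    · exact Or.inr ⟨mem_univ _, hc, hns, h⟩
  have h1 : ((univ.filter fun π : Equiv.Perm (Slot m q) => (U ∈ Uex3 μ π ∧ M ∈ Mex3 π) ∧ Bad μ ε θ 𝒰 ℳ π).card : ℝ) ≤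
      ((univ.filter fun π : Equiv.Perm (Slot m q) => Compat μ U M π ∧ UBad μ ε θ 𝒰 ℳ π).card : ℝ) +
        ((univ.filter fun π : Equiv.Perm (Slot m q) => Compat μ U M π ∧ MBad μ ε θ 𝒰 ℳ π).card : ℝ) := by
    exact_mod_cast (card_le_card hsub).trans (card_union_le _ _)
  have hC : (univ.filter fun π : Equiv.Perm (Slot m q) => Compat μ U M π) =
      (univ.filter fun π : Equiv.Perm (Slot m q) => U ∈ Uex3 μ π ∧ M ∈ Mex3 π) := by
    ext π; simp [Compat]
  rw [hC] at hU hM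
  linarith

/-- **Lemma 7** (slot model, sums instead of expectations): for a rectangle with `μ₁(ℛ) = 0`,
`Σ_π p^ex_U p^ex_M ≤ 2(1+ε)³ρ · Σ_π p^ex_U(F) p^ex_M(F) + 2θ|Ω|`.
[cite: Rothvoss2017, Lemma 7 and eq. (7) (PDF pp. 6, 9)] -/
theorem sum_pp_le (hq : 0 < q) (hqe : Even q) (hm : m = 2 * μ + 1) (hε : 0 < ε)
    (hθ : 0 < θ) (hθ1 : θ ≤ 1)
    (hβU : (Real.log 2 + Real.log ((m : ℝ) + 1) - Real.log θ) / cU ε ≤ ((μ : ℝ) + 1) / 4)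
    (hβM : ((2 * q).factorial : ℝ) * ((Real.log (Qbound q : ℝ) - Real.log θ) / cM q ε) ≤ (m : ℝ) / 4)
    (hR1 : ∀ U ∈ 𝒰, ∀ M ∈ ℳ, (M.filter fun e => cutCount U e = 1).card ≠ 1) :
    ∑ π : Equiv.Perm (Slot m q), pU3 μ 𝒰 π * pM3 ℳ π ≤
      2 * ((1 + ε) ^ 3 * ((3 * (q + 3) : ℝ) / Nat.choose (q + 3) 3)) *
          ∑ π : Equiv.Perm (Slot m q), pUC μ 𝒰 π * pMF ℳ π +
        2 * (θ * Fintype.card (Equiv.Perm (Slot m q))) := by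
  have hG := sum_good_le μ ε 𝒰 ℳ hε.le hq hqe hm hR1
  have hS := sum_small_le μ θ 𝒰 ℳ hq hqe hm hθ.le
  have hB := sum_bad_le μ ε θ 𝒰 ℳ hq (εb := 1 / 2)
    (fun U _ M _ => card_compat_bad_le μ ε θ 𝒰 ℳ hq hqe hm hε hθ hθ1 hβU hβM U M)
  have hsplit : ∑ π : Equiv.Perm (Slot m q), pU3 μ 𝒰 π * pM3 ℳ π ≤
      ∑ π : Equiv.Perm (Slot m q), (if Good μ ε 𝒰 ℳ π then pU3 μ 𝒰 π * pM3 ℳ π else 0) +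
      ∑ π : Equiv.Perm (Slot m q), (if Small μ θ 𝒰 ℳ π then pU3 μ 𝒰 π * pM3 ℳ π else 0) +
      ∑ π : Equiv.Perm (Slot m q), (if Bad μ ε θ 𝒰 ℳ π then pU3 μ 𝒰 π * pM3 ℳ π else 0) := by
    rw [← sum_add_distrib, ← sum_add_distrib]
    refine sum_le_sum fun π _ => ?_
    have h0 : 0 ≤ pU3 μ 𝒰 π * pM3 ℳ π := mul_nonneg (pU3_nonneg μ 𝒰 π) (pM3_nonneg ℳ π)
    by_cases hg : Good μ ε 𝒰 ℳ π
    · rw [if_pos hg]; split_ifs <;> linarith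
    · by_cases hs : Small μ θ 𝒰 ℳ π
      · rw [if_neg hg, if_pos hs]; split_ifs <;> linarith
      · have hb : Bad μ ε θ 𝒰 ℳ π := ⟨hg, hs⟩
        rw [if_neg hg, if_neg hs, if_pos hb]; linarith
  linarith

/-- `μ₃ ≤ 1` in sum form. [folklore] -/
theorem sum_pp_le_card : ∑ π : Equiv.Perm (Slot m q), pU3 μ 𝒰 π * pM3 ℳ π ≤ Fintype.card (Equiv.Perm (Slot m q)) := by
  calc ∑ π : Equiv.Perm (Slot m q), pU3 μ 𝒰 π * pM3 ℳ π ≤ ∑ _π : Equiv.Perm (Slot m q), (1 : ℝ) :=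
        sum_le_sum fun π _ => by
          calc pU3 μ 𝒰 π * pM3 ℳ π ≤ 1 * 1 :=
                mul_le_mul (pU3_le_one μ 𝒰 π) (pM3_le_one ℳ π) (pM3_nonneg ℳ π) zero_le_one
            _ = 1 := one_mul 1
    _ = Fintype.card (Equiv.Perm (Slot m q)) := by simp

/-- **Lemma 6**: every rectangle sum of `W` is at most `2θ`. [cite: Rothvoss2017, Lemma 6 (PDF p. 6)] -/
theorem rect_le (hq : 0 < q) (hqe : Even q) (hm : m = 2 * μ + 1) (hε : 0 < ε)
    (hθ : 0 < θ) (hθ1 : θ ≤ 1)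
    (hβU : (Real.log 2 + Real.log ((m : ℝ) + 1) - Real.log θ) / cU ε ≤ ((μ : ℝ) + 1) / 4)
    (hβM : ((2 * q).factorial : ℝ) * ((Real.log (Qbound q : ℝ) - Real.log θ) / cM q ε) ≤ (m : ℝ) / 4)
    (hk : 2 * ((1 + ε) ^ 3 * ((3 * (q + 3) : ℝ) / Nat.choose (q + 3) 3)) ≤ 1 / ((q : ℝ) + 2)) :
    ∑ U ∈ 𝒰, ∑ M ∈ ℳ, Wmat q μ U M ≤ 2 * θ := by
  rw [sum_Wmat]
  have hN : (0 : ℝ) < Fintype.card (Equiv.Perm (Slot m q)) := by exact_mod_cast Fintype.card_pos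
  have hmuK : 0 ≤ muK μ 𝒰 ℳ := by
    unfold muK
    exact div_nonneg (sum_nonneg fun π _ => mul_nonneg (pUC_nonneg μ 𝒰 π) (pMF_nonneg ℳ π)) hN.le
  have hmu3 : mu3 μ 𝒰 ℳ ≤ 1 := by
    unfold mu3
    rw [div_le_one hN]
    exact sum_pp_le_card μ 𝒰 ℳ
  have hind : 0 ≤ ∑ U ∈ 𝒰, ∑ M ∈ ℳ, (if (M.filter fun e => cutCount U e = 1).card = 1 then (1 : ℝ) else 0) :=
    sum_nonneg fun U _ => sum_nonneg fun M _ => by split_ifs <;> norm_num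
  by_cases h1 : ∃ U ∈ 𝒰, ∃ M ∈ ℳ, (M.filter fun e => cutCount U e = 1).card = 1
  · -- a pair with `|δ(U) ∩ M| = 1`: the penalty dominates
    obtain ⟨U₀, hU₀, M₀, hM₀, hc⟩ := h1
    have hge : (1 : ℝ) ≤ ∑ U ∈ 𝒰, ∑ M ∈ ℳ, (if (M.filter fun e => cutCount U e = 1).card = 1 then (1 : ℝ) else 0) := by
      calc (1 : ℝ) = (if (M₀.filter fun e => cutCount U₀ e = 1).card = 1 then (1 : ℝ) else 0) := by rw [if_pos hc]
        _ ≤ ∑ M ∈ ℳ, (if (M.filter fun e => cutCount U₀ e = 1).card = 1 then (1 : ℝ) else 0) :=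
            single_le_sum (f := fun M => (if (M.filter fun e => cutCount U₀ e = 1).card = 1 then (1 : ℝ) else 0))
              (fun M _ => by split_ifs <;> norm_num) hM₀
        _ ≤ ∑ U ∈ 𝒰, ∑ M ∈ ℳ, (if (M.filter fun e => cutCount U e = 1).card = 1 then (1 : ℝ) else 0) :=
            single_le_sum (f := fun U => ∑ M ∈ ℳ, (if (M.filter fun e => cutCount U e = 1).card = 1 then (1 : ℝ) else 0))
              (fun U _ => sum_nonneg fun M _ => by split_ifs <;> norm_num) hU₀
    have : 0 ≤ muK μ 𝒰 ℳ / ((q : ℝ) + 2) := by positivity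
    linarith
  · -- `μ₁(ℛ) = 0`: Lemma 7
    push Not at h1
    have h0 : ∑ U ∈ 𝒰, ∑ M ∈ ℳ, (if (M.filter fun e => cutCount U e = 1).card = 1 then (1 : ℝ) else 0) = 0 := by
      refine sum_eq_zero fun U hU => sum_eq_zero fun M hM => ?_
      rw [if_neg (h1 U hU M hM)]
    rw [h0, neg_zero, zero_add]
    have hL7 := sum_pp_le μ ε θ 𝒰 ℳ hq hqe hm hε hθ hθ1 hβU hβM h1
    -- divide by `|Ω|`
    set ρ' : ℝ := 2 * ((1 + ε) ^ 3 * ((3 * (q + 3) : ℝ) / Nat.choose (q + 3) 3)) with hρ'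
    have hmu3' : mu3 μ 𝒰 ℳ ≤ ρ' * muK μ 𝒰 ℳ + 2 * θ := by
      unfold mu3 muK
      rw [div_le_iff₀ hN, add_mul, mul_assoc, div_mul_cancel₀ _ hN.ne']
      linarith
    have hq2 : (0 : ℝ) < (q : ℝ) + 2 := by positivity
    have : ρ' * muK μ 𝒰 ℳ ≤ muK μ 𝒰 ℳ / ((q : ℝ) + 2) := by
      rw [le_div_iff₀ hq2]
      calc ρ' * muK μ 𝒰 ℳ * ((q : ℝ) + 2) = (ρ' * ((q : ℝ) + 2)) * muK μ 𝒰 ℳ := by ring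
        _ ≤ 1 * muK μ 𝒰 ℳ := by
            apply mul_le_mul_of_nonneg_right _ hmuK
            rw [← le_div_iff₀ hq2]; exact hk
        _ = muK μ 𝒰 ℳ := one_mul _
    linarith

/-- **The weight datum of Lemma 6 on the slot type**: rectangle sums `≤ 2θ`, `⟨W, S⟩ = 1`.
[cite: Rothvoss2017, Lemma 6 and eq. (2) (PDF p. 6)] -/
theorem exists_W_slot (hq : 0 < q) (hqe : Even q) (hm : m = 2 * μ + 1) (hε : 0 < ε)
    (hθ : 0 < θ) (hθ1 : θ ≤ 1)
    (hβU : (Real.log 2 + Real.log ((m : ℝ) + 1) - Real.log θ) / cU ε ≤ ((μ : ℝ) + 1) / 4)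
    (hβM : ((2 * q).factorial : ℝ) * ((Real.log (Qbound q : ℝ) - Real.log θ) / cM q ε) ≤ (m : ℝ) / 4)
    (hk : 2 * ((1 + ε) ^ 3 * ((3 * (q + 3) : ℝ) / Nat.choose (q + 3) 3)) ≤ 1 / ((q : ℝ) + 2)) :
    ∃ W : {U : Finset (Slot m q) // U.card = tCut q μ} → {M : Finset (Sym2 (Slot m q)) // IsPMOn univ M} → ℝ,
      (∀ (X : Finset {U : Finset (Slot m q) // U.card = tCut q μ})
          (Y : Finset {M : Finset (Sym2 (Slot m q)) // IsPMOn univ M}),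
          ∑ a ∈ X, ∑ b ∈ Y, W a b ≤ 2 * θ) ∧
        ∑ a, ∑ b, W a b * ((((b : Finset (Sym2 (Slot m q))).filter
          fun f => cutCount (a : Finset (Slot m q)) f = 1).card : ℝ) - 1) = 1 := by
  refine ⟨fun a b => Wmat q μ a.1 b.1, fun X Y => ?_, sum_Wmat_slack hq hqe hm⟩
  have := rect_le μ ε θ (X.map (Function.Embedding.subtype _)) (Y.map (Function.Embedding.subtype _))
    hq hqe hm hε hθ hθ1 hβU hβM hk
  rw [sum_map] at this
  simpa only [sum_map, Function.Embedding.coe_subtype] using this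

end

end Literature.Barriers.PneNP

end


/-! ## Part: `TSPExtensionComplexityRothvossFinal` -/

/-!
# Discharge of `Rothvoss2017_tsp`: `xc(TSP(n)) ≥ 2^{Ω(n)}`

`theorem Rothvoss2017_tsp_holds : Rothvoss2017_tsp` — Rothvoß 2017, Cor. 2 ("for every `n` …
`xc(conv(χ_C : C Hamiltonian cycle of K_n)) ≥ 2^{Ω(n)}`", PDF p. 4), proved along the printed
route with explicit constants:

1. (§3, Lemmas 6–7, sibling files `…Rothvoss*.lean`) on the slot type `Slot m 72`
   (`n = 216m + 150` vertices, `k = 75`, `ε = 1/8`, `θ = 2^{-δm}`): a weight matrix on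
   (`t`-cuts) × (perfect matchings) with all rectangle sums `≤ 2θ` and `⟨W,S⟩ = 1`
   (`exists_W_slot`), transported to `Fin n` (`exists_weights_transport`);
2. (§2, Thm. 4 / Lemma 5) `HasEFOfSize.pm_hyperplane_separation`: an EF of the perfect matching
   polytope with `R` inequalities forces `1 ≤ (R+1)(t-1)·2θ`;
3. (Yannakakis / §1, "a linear projection of a face of the TSP polytope", PDF p. 4)
   `hasEF_pmPolytope_of_tsp`: `PM(n)` from `TSP(2n + n/2 + s)` at cost `C(N,2)` extra rows;
4. arithmetic: `N ≥ N₀ ⇒ 2^{(δ/1200) N} ≤ r`.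

[cite: Rothvoss2017, Thm. 1, Cor. 2 (PDF p. 4); Lemmas 5–7 (PDF p. 6); §3 (PDF pp. 8–12)]
-/

noncomputable section

open scoped Classical

namespace Literature.Barriers.PneNP

open Finset Slot Filter

/-! ### Constants -/

/-- `k - 3 = 72`. [folklore] -/
def qR : ℕ := 72
/-- `ε = 1/8`. [folklore] -/
def εR : ℝ := 1 / 8
/-- `(2q)!`, kept opaque for the arithmetic. [folklore] -/
irreducible_def FQ : ℝ := ((2 * qR).factorial : ℝ)
/-- The bound `Q` on `|PM(B̃_i)|`, kept opaque. [folklore] -/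
irreducible_def QB : ℝ := ((Qbound qR : ℕ) : ℝ)
/-- The decay rate `δ`. [folklore] -/
def δR : ℝ := min (cU εR / (32 * Real.log 2)) (cM qR εR / (16 * FQ * Real.log 2))
/-- `θ = 2^{-δm}`. [folklore] -/
def θR (m : ℕ) : ℝ := (2 : ℝ) ^ (-(δR * m))

/-- Auxiliary (`cU_pos`). [folklore] -/
theorem cU_pos : 0 < cU εR := by unfold cU εR; positivity
/-- Auxiliary (`cM_pos`). [folklore] -/
theorem cM_pos : 0 < cM qR εR := by
  have h1 : (1 : ℝ) ≤ ((Qbound qR : ℕ) : ℝ) := by exact_mod_cast one_le_Qbound qR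
  have hε : (0 : ℝ) < εR := by unfold εR; norm_num
  unfold cM
  apply div_pos (pow_pos (div_pos hε (mul_pos (by linarith) (by linarith))) 2) (by norm_num)
/-- Auxiliary (`FQ_pos`). [folklore] -/
theorem FQ_pos : 0 < FQ := by rw [FQ_def]; exact_mod_cast Nat.factorial_pos _
/-- Auxiliary (`one_le_QB`). [folklore] -/
theorem one_le_QB : 1 ≤ QB := by rw [QB_def]; exact_mod_cast one_le_Qbound qR
/-- Auxiliary (`log_two_pos'`). [folklore] -/
theorem log_two_pos' : 0 < Real.log 2 := Real.log_pos (by norm_num)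
/-- Auxiliary (`log_two_lt_one`). [folklore] -/
theorem log_two_lt_one : Real.log 2 < 1 := by
  have := Real.log_two_lt_d9; linarith
/-- Auxiliary (`δR_pos`). [folklore] -/
theorem δR_pos : 0 < δR := by
  have h1 := cU_pos; have h2 := cM_pos; have h3 := log_two_pos'; have h4 := FQ_pos
  exact lt_min (div_pos h1 (mul_pos (by norm_num) h3)) (div_pos h2 (mul_pos (mul_pos (by norm_num) h4) h3))
/-- Auxiliary (`δR_le_U`). [folklore] -/
theorem δR_le_U : δR ≤ cU εR / (32 * Real.log 2) := min_le_left _ _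
/-- Auxiliary (`δR_le_M`). [folklore] -/
theorem δR_le_M : δR ≤ cM qR εR / (16 * FQ * Real.log 2) := min_le_right _ _

/-- Auxiliary (`θR_pos`). [folklore] -/
theorem θR_pos (m : ℕ) : 0 < θR m := Real.rpow_pos_of_pos (by norm_num) _
/-- Auxiliary (`θR_le_one`). [folklore] -/
theorem θR_le_one (m : ℕ) : θR m ≤ 1 := by
  unfold θR
  apply Real.rpow_le_one_of_one_le_of_nonpos (by norm_num)
  have := δR_pos
  have : 0 ≤ δR * m := mul_nonneg this.le (Nat.cast_nonneg m)
  linarith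
/-- Auxiliary (`log_θR`). [folklore] -/
theorem log_θR (m : ℕ) : Real.log (θR m) = -(δR * m) * Real.log 2 := by
  unfold θR
  rw [Real.log_rpow (by norm_num)]
/-- Auxiliary (`θR_mul_rpow`). [folklore] -/
theorem θR_mul_rpow (m : ℕ) : θR m * (2 : ℝ) ^ (δR * m) = 1 := by
  unfold θR
  rw [← Real.rpow_add (by norm_num)]
  simp

/-- `log x ≤ 2 √x`. [folklore] -/
private theorem log_le_two_sqrt {x : ℝ} (hx : 0 < x) : Real.log x ≤ 2 * Real.sqrt x := by
  have h := Real.log_le_sub_one_of_pos (Real.sqrt_pos.2 hx)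
  rw [Real.log_sqrt hx.le] at h
  linarith [Real.sqrt_nonneg x]

/-- The numerical condition of Lemma 6: `2(1+ε)³ · 3k/C(k,3) ≤ 1/(k-1)` for `k = 75`, `ε = 1/8`.
[folklore] -/
theorem hk_num : 2 * ((1 + εR) ^ 3 * ((3 * (qR + 3) : ℝ) / Nat.choose (qR + 3) 3)) ≤ 1 / ((qR : ℝ) + 2) := by
  have hc : Nat.choose (qR + 3) 3 = 67525 := by decide
  rw [hc]
  unfold εR qR
  norm_num

/-- Largeness for Lemma 14. [folklore] -/
theorem betaU_ok (μ : ℕ) {m : ℕ} (hm : m = 2 * μ + 1)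
    (h1 : (64 / cU εR) ^ 2 ≤ (m : ℝ) + 1) (h2 : 32 / cU εR ≤ (m : ℝ) + 1) :
    (Real.log 2 + Real.log ((m : ℝ) + 1) - Real.log (θR m)) / cU εR ≤ ((μ : ℝ) + 1) / 4 := by
  have hc := cU_pos
  have hl2 := log_two_pos'
  rw [log_θR, div_le_iff₀ hc]
  have hμ : ((μ : ℝ) + 1) = ((m : ℝ) + 1) / 2 := by rw [hm]; push_cast; ring
  rw [hμ]
  have hm0 : (0 : ℝ) ≤ m := Nat.cast_nonneg m
  -- (i) the `δ` term
  have hi : δR * m * Real.log 2 ≤ cU εR * ((m : ℝ) + 1) / 32 := by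
    have hδ := δR_le_U
    calc δR * m * Real.log 2 ≤ (cU εR / (32 * Real.log 2)) * m * Real.log 2 :=
          mul_le_mul_of_nonneg_right (mul_le_mul_of_nonneg_right hδ hm0) hl2.le
      _ = cU εR * m / 32 := by field_simp
      _ ≤ cU εR * ((m : ℝ) + 1) / 32 := by
          apply div_le_div_of_nonneg_right _ (by norm_num)
          exact mul_le_mul_of_nonneg_left (by linarith) hc.le
  -- (ii) the `log (m+1)` term
  have hii : Real.log ((m : ℝ) + 1) ≤ cU εR * ((m : ℝ) + 1) / 32 := by
    have hpos : (0 : ℝ) < (m : ℝ) + 1 := by linarith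
    refine (log_le_two_sqrt hpos).trans ?_
    have hs : 64 / cU εR ≤ Real.sqrt ((m : ℝ) + 1) := by
      rw [Real.le_sqrt (div_nonneg (by norm_num) hc.le) hpos.le]; exact h1
    have hsq : Real.sqrt ((m : ℝ) + 1) * Real.sqrt ((m : ℝ) + 1) = (m : ℝ) + 1 := Real.mul_self_sqrt hpos.le
    have hs' : 64 ≤ cU εR * Real.sqrt ((m : ℝ) + 1) := by
      rw [div_le_iff₀ hc] at hs; linarith
    have hsn : 0 ≤ Real.sqrt ((m : ℝ) + 1) := Real.sqrt_nonneg _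
    calc 2 * Real.sqrt ((m : ℝ) + 1) = (64 * Real.sqrt ((m : ℝ) + 1)) / 32 := by ring
      _ ≤ (cU εR * Real.sqrt ((m : ℝ) + 1) * Real.sqrt ((m : ℝ) + 1)) / 32 := by
          apply div_le_div_of_nonneg_right _ (by norm_num)
          exact mul_le_mul_of_nonneg_right hs' hsn
      _ = cU εR * ((m : ℝ) + 1) / 32 := by rw [mul_assoc, hsq]
  -- (iii) the constant
  have hiii : Real.log 2 ≤ cU εR * ((m : ℝ) + 1) / 32 := by
    have := log_two_lt_one
    have h2' : 32 ≤ cU εR * ((m : ℝ) + 1) := by rwa [div_le_iff₀ hc, mul_comm] at h2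
    linarith
  have hsum : Real.log 2 + Real.log ((m : ℝ) + 1) - -(δR * m) * Real.log 2 ≤ 3 * (cU εR * ((m : ℝ) + 1) / 32) := by
    linarith
  calc Real.log 2 + Real.log ((m : ℝ) + 1) - -(δR * m) * Real.log 2 ≤ 3 * (cU εR * ((m : ℝ) + 1) / 32) := hsum
    _ ≤ ((m : ℝ) + 1) / 2 / 4 * cU εR := by
        have : 0 ≤ cU εR * ((m : ℝ) + 1) := mul_nonneg hc.le (by linarith)
        nlinarith

/-- Largeness for Lemma 15. [folklore] -/
theorem betaM_ok {m : ℕ} (h1 : 16 * FQ * Real.log QB / cM qR εR ≤ (m : ℝ)) :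
    ((2 * qR).factorial : ℝ) * ((Real.log (Qbound qR : ℝ) - Real.log (θR m)) / cM qR εR) ≤ (m : ℝ) / 4 := by
  rw [← FQ_def, ← QB_def, log_θR]
  have hc := cM_pos
  have hl2 := log_two_pos'
  have hF := FQ_pos
  have hm0 : (0 : ℝ) ≤ m := Nat.cast_nonneg m
  have hi : FQ * (δR * m * Real.log 2) / cM qR εR ≤ (m : ℝ) / 16 := by
    have hδ := δR_le_M
    rw [div_le_iff₀ hc]
    calc FQ * (δR * m * Real.log 2) ≤ FQ * ((cM qR εR / (16 * FQ * Real.log 2)) * m * Real.log 2) :=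
          mul_le_mul_of_nonneg_left (mul_le_mul_of_nonneg_right (mul_le_mul_of_nonneg_right hδ hm0) hl2.le) hF.le
      _ = (m : ℝ) / 16 * cM qR εR := by field_simp
  have hii : FQ * Real.log QB / cM qR εR ≤ (m : ℝ) / 16 := by
    rw [div_le_iff₀ hc]
    rw [div_le_iff₀ hc] at h1
    linarith
  have hsplit : FQ * ((Real.log QB - -(δR * m) * Real.log 2) / cM qR εR) =
      FQ * Real.log QB / cM qR εR + FQ * (δR * m * Real.log 2) / cM qR εR := by
    field_simp
    ring
  rw [hsplit]
  linarith

/-! ### The bound for the perfect matching polytope -/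

/-- **Theorem 1 in quantitative form** (slot model size): an EF of `PM(n)`, `n = |Slot m 72|`,
`m = 2μ+1` large, with `R` inequalities has `1 ≤ (R+1) (t-1) · 2θ`.
[cite: Rothvoss2017, Thm. 1 with Thm. 4 / Lemmas 5–6 (PDF pp. 4–6)] -/
theorem pm_bound (μ : ℕ) {m : ℕ} (hm : m = 2 * μ + 1)
    (hU1 : (64 / cU εR) ^ 2 ≤ (m : ℝ) + 1) (hU2 : 32 / cU εR ≤ (m : ℝ) + 1)
    (hM1 : 16 * FQ * Real.log QB / cM qR εR ≤ (m : ℝ))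
    {R : ℕ} (hR : HasEFOfSize (pmPolytope (Fintype.card (Slot m qR))) R) :
    1 ≤ ((R : ℝ) + 1) * (((tCut qR μ - 1 : ℕ) : ℝ) * (2 * θR m)) := by
  have hq : 0 < qR := by unfold qR; norm_num
  have hqe : Even qR := by unfold qR; decide
  have hε : (0 : ℝ) < εR := by unfold εR; norm_num
  obtain ⟨W, hrect, hsum⟩ := exists_weights_transport (Fintype.equivFin (Slot m qR)) (tCut qR μ) (2 * θR m) 1
    (exists_W_slot (m := m) (q := qR) μ εR (θR m) hq hqe hm hε (θR_pos m) (θR_le_one m)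
      (betaU_ok μ hm hU1 hU2) (betaM_ok hM1) hk_num)
  have ht : Odd (tCut qR μ) := by
    unfold tCut qR
    exact Even.add_odd (Even.mul_left (by decide) _) (by decide)
  have key := hR.pm_hyperplane_separation ht W (2 * θR m) hrect
  rw [hsum] at key
  exact key

/-! ### Arithmetic -/

/-- `x³ ≤ exp (3x)` for `x ≥ 0`. [folklore] -/
private theorem cube_le_exp {x : ℝ} (hx : 0 ≤ x) : x ^ 3 ≤ Real.exp (3 * x) := by
  have h1 : x ≤ Real.exp x := by have := Real.add_one_le_exp x; linarith
  calc x ^ 3 ≤ (Real.exp x) ^ 3 := pow_le_pow_left₀ hx h1 3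
    _ = Real.exp (3 * x) := by rw [← Real.exp_nat_mul]; norm_num

/-- From Lemma 5's inequality to `2^{δm} ≤ 2N(N² + r + 1)`. [folklore] -/
theorem arith_one {R T θ P N r : ℝ} (hkey : 1 ≤ (R + 1) * (T * (2 * θ))) (hR : R ≤ N ^ 2 + r)
    (hT : T ≤ N) (hT0 : 0 ≤ T) (hθ : 0 < θ) (hr : 0 ≤ r) (hP : θ * P = 1)
    (hP0 : 0 < P) : P ≤ 2 * N * (N ^ 2 + r + 1) := by
  have h1 : (R + 1) * (T * (2 * θ)) ≤ (N ^ 2 + r + 1) * (N * (2 * θ)) := by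
    apply mul_le_mul (by linarith) (mul_le_mul_of_nonneg_right hT (by linarith)) _ (by positivity)
    exact mul_nonneg hT0 (by linarith)
  have h2 : 1 ≤ (N ^ 2 + r + 1) * (N * (2 * θ)) := hkey.trans h1
  calc P = 1 * P := (one_mul P).symm
    _ ≤ ((N ^ 2 + r + 1) * (N * (2 * θ))) * P := mul_le_mul_of_nonneg_right h2 hP0.le
    _ = 2 * N * (N ^ 2 + r + 1) * (θ * P) := by ring
    _ = 2 * N * (N ^ 2 + r + 1) := by rw [hP, mul_one]

/-- The final comparison: `y ≥ 8N²`, `y² ≤ P ≤ 2N(N²+r+1)` force `y ≤ r`. [folklore] -/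
theorem arith_two {N y r P : ℝ} (hN1 : 1 ≤ N) (hy8 : 8 * N ^ 2 ≤ y) (hy2 : y ^ 2 ≤ P)
    (hP : P ≤ 2 * N * (N ^ 2 + r + 1)) : y ≤ r := by
  by_contra hlt
  push Not at hlt
  have hy0 : 0 ≤ y := le_trans (by positivity) hy8
  have h1 : y ^ 2 < 2 * N * (N ^ 2 + y + 1) := by
    have : 2 * N * (N ^ 2 + r + 1) < 2 * N * (N ^ 2 + y + 1) := by nlinarith
    linarith
  have ha : 4 * N ≤ y := by nlinarith
  have hb : 2 * N * (N ^ 2 + 1) ≤ y ^ 2 / 2 := by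
    have : 2 * N ^ 2 + 2 ≤ y := by nlinarith
    nlinarith
  nlinarith

/-- `C(N+1, 2) ≤ N²`. [folklore] -/
theorem choose_succ_two_le_sq (N : ℕ) : (N + 1).choose 2 ≤ N ^ 2 := by
  rw [Nat.choose_two_right]
  apply Nat.div_le_of_le_mul
  have : (N + 1) * (N + 1 - 1) = (N + 1) * N := by simp
  rw [this]
  nlinarith

/-! ### The main theorem -/

/-- **Rothvoß 2017, Cor. 2**: `xc(TSP(n)) ≥ 2^{cn}` for all large `n`, with `c = δ/1200`.
[cite: Rothvoss2017, Cor. 2 (PDF p. 4)] -/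
theorem Rothvoss2017_tsp_holds : Rothvoss2017_tsp := by
  have hδ := δR_pos
  have hl2 := log_two_pos'
  have hcU := cU_pos
  -- thresholds
  set κ : ℝ := δR * Real.log 2 / 3600 with hκ
  have hκpos : 0 < κ := div_pos (mul_pos hδ hl2) (by norm_num)
  set T : ℝ := max (max (600 * ((64 / cU εR) ^ 2)) (600 * (32 / cU εR)))
    (max (600 * (16 * FQ * Real.log QB / cM qR εR)) (8 / κ ^ 3)) with hT
  refine ⟨δR / 1200, div_pos hδ (by norm_num), ?_⟩
  filter_upwards [eventually_ge_atTop (max 15000 ⌈T⌉₊)] with N hN r hr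
  have hN15 : 15000 ≤ N := le_of_max_le_left hN
  have hNT : T ≤ (N : ℝ) := (Nat.le_ceil T).trans (by exact_mod_cast le_of_max_le_right hN)
  have hT1 : 600 * ((64 / cU εR) ^ 2) ≤ (N : ℝ) := le_trans (le_trans (le_max_left _ _) (le_max_left _ _)) hNT
  have hT2 : 600 * (32 / cU εR) ≤ (N : ℝ) := le_trans (le_trans (le_max_right _ _) (le_max_left _ _)) hNT
  have hT3 : 600 * (16 * FQ * Real.log QB / cM qR εR) ≤ (N : ℝ) :=
    le_trans (le_trans (le_max_left _ _) (le_max_right _ _)) hNT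
  have hT4 : 8 / κ ^ 3 ≤ (N : ℝ) := le_trans (le_trans (le_max_right _ _) (le_max_right _ _)) hNT
  -- the parameters
  set μ := (N - 915) / 1080 with hμ
  set m := 2 * μ + 1 with hm
  have hdiv : N - 915 < 1080 * (μ + 1) := by
    have := Nat.lt_div_mul_add (a := N - 915) (b := 1080) (by norm_num)
    rw [hμ]; linarith
  have hmN : N ≤ 600 * m := by omega
  have hmR : (N : ℝ) ≤ 600 * (m : ℝ) := by exact_mod_cast hmN
  have h600 : (0 : ℝ) < 600 := by norm_num
  -- the largeness hypotheses
  have hA1 : (64 / cU εR) ^ 2 ≤ (m : ℝ) := le_of_mul_le_mul_left (hT1.trans hmR) h600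
  have hA2 : 32 / cU εR ≤ (m : ℝ) := le_of_mul_le_mul_left (hT2.trans hmR) h600
  have hA3 : 16 * FQ * Real.log QB / cM qR εR ≤ (m : ℝ) := le_of_mul_le_mul_left (hT3.trans hmR) h600
  have hm1 : (m : ℝ) ≤ (m : ℝ) + 1 := by linarith
  set n := Fintype.card (Slot m qR) with hn
  have hn' : n = 216 * m + 150 := by rw [hn, Slot.card]; unfold qR; ring
  set h := 108 * m + 75 with hh
  have hhn : 2 * h = n := by rw [hn', hh]; ring
  obtain ⟨s, hs⟩ : ∃ s, N = 2 * n + h + s := ⟨N - (2 * n + h), by omega⟩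
  -- the EF of `PM(n)` from the face of `TSP(N)`
  have hn0 : 0 < n := by rw [hn']; omega
  have hr' : HasEFOfSize (tspPolytope (2 * n + h + s)) r := hs ▸ hr
  have hpm := hasEF_pmPolytope_of_tsp hhn hn0 hr'
  have key := pm_bound μ hm (hA1.trans hm1) (hA2.trans hm1) hA3 hpm
  -- sizes: `|E(K_N)| ≤ N²`, `t - 1 ≤ N`
  set E := Fintype.card (⊤ : SimpleGraph (Fin (2 * n + h + s))).edgeSet with hE
  have hEle : E ≤ N ^ 2 := by
    have h1 : E ≤ Fintype.card (Sym2 (Fin (2 * n + h + s))) :=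
      Fintype.card_le_of_injective (fun x => x.1) Subtype.val_injective
    rw [Sym2.card, Fintype.card_fin, ← hs] at h1
    exact h1.trans (choose_succ_two_le_sq N)
  have hEleR : ((E + r : ℕ) : ℝ) ≤ (N : ℝ) ^ 2 + r := by
    have : ((E : ℕ) : ℝ) ≤ ((N ^ 2 : ℕ) : ℝ) := by exact_mod_cast hEle
    push_cast at this ⊢
    exact add_le_add this le_rfl
  have htle : (((tCut qR μ - 1 : ℕ) : ℝ)) ≤ N := by
    have : tCut qR μ - 1 ≤ N := by unfold tCut qR; omega
    exact_mod_cast this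
  -- `2^{δm} ≤ 2N (N² + r + 1)`
  have hr0 : (0 : ℝ) ≤ r := Nat.cast_nonneg r
  have hPpos : (0 : ℝ) < (2 : ℝ) ^ (δR * m) := Real.rpow_pos_of_pos (by norm_num) _
  have hpow : (2 : ℝ) ^ (δR * m) ≤ 2 * N * ((N : ℝ) ^ 2 + r + 1) :=
    arith_one key hEleR htle (Nat.cast_nonneg _) (θR_pos m) hr0 (θR_mul_rpow m) hPpos
  -- `y = 2^{(δ/1200) N}`: `y² ≤ 2^{δm}`, `y ≥ (κN)³ ≥ 8N²`
  set y : ℝ := (2 : ℝ) ^ (δR / 1200 * N) with hy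
  have hy2 : y ^ 2 ≤ (2 : ℝ) ^ (δR * m) := by
    rw [hy, ← Real.rpow_natCast, ← Real.rpow_mul (by norm_num)]
    apply Real.rpow_le_rpow_of_exponent_le (by norm_num)
    have h1 : δR / 1200 * N * ((2 : ℕ) : ℝ) = δR * ((N : ℝ) / 600) := by push_cast; ring
    rw [h1]
    exact mul_le_mul_of_nonneg_left (by rw [div_le_iff₀ h600, mul_comm]; exact hmR) hδ.le
  have hy3 : (κ * N) ^ 3 ≤ y := by
    have h1 := cube_le_exp (x := κ * N) (mul_nonneg hκpos.le (Nat.cast_nonneg N))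
    have h2 : y = Real.exp (3 * (κ * N)) := by
      rw [hy, Real.rpow_def_of_pos (by norm_num), hκ]
      congr 1
      ring
    rw [h2]
    exact h1
  have hN1 : (1 : ℝ) ≤ N := by exact_mod_cast (show 1 ≤ N by omega)
  have hyN : 8 * (N : ℝ) ^ 2 ≤ y := by
    have hk3 : 0 < κ ^ 3 := pow_pos hκpos 3
    have h8 : 8 ≤ (N : ℝ) * κ ^ 3 := by rwa [div_le_iff₀ hk3] at hT4
    calc 8 * (N : ℝ) ^ 2 ≤ ((N : ℝ) * κ ^ 3) * (N : ℝ) ^ 2 :=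
          mul_le_mul_of_nonneg_right h8 (sq_nonneg _)
      _ = (κ * N) ^ 3 := by ring
      _ ≤ y := hy3
  -- conclude
  show (2 : ℝ) ^ (δR / 1200 * N) ≤ r
  exact arith_two hN1 hyN hy2 hpow

end Literature.Barriers.PneNP

end
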